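import Literature.Analysis.ValidatedNumerics.GaussLegendreCert2D
import HarnessLib

/-!
# Kernel-checked tensor-product Gauss–Legendre cubature certificates in `d` variables: enclosures of
# `∫…∫ f(x₀, …, x_{d−1})` over a box, for integrands analytic in each variable separately, by one `decide`

Trunk T-ANA (Analysis/ValidatedNumerics); namespace `Literature.Analysis.ValidatedNumerics.GaussLegendreND`.
Sequel of `GaussLegendreCert.lean` (one variable: the ellipse majorant calculus `EB`/`EBnd`, the exact integer sign
test `legInt` isolating the nodes, Bonnet's recursion `legPair` enclosing the weights, the interval kernels `MI`/`MC`,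
the untrusted node search `glCands`) and of `GaussLegendreCert2D.lean` (two variables: the degenerate real box `realB`,
the transported rule `glRule` with its generic error bound `abs_integral_sub_gl_le_of`, the certified per-axis
node/weight tables `axisNW`/`axisTab` and the bracket-to-node correspondence `axis_nodes`), which it generalises from
`d = 2` to EVERY dimension `d`. [cite: MahboubiMelquiondSibutpinote2016, Sect. 4.1].

THE PROBLEM (Davis–Rabinowitz, Sect. 5.6): over the box `G = Π_k [a_k, b_k]` the natural rule is the PRODUCT
`Π_k Q_k` of `d` one-dimensional rules ((5.6.3)), and HABER'S ERROR ESTIMATE bounds its error by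
`E₁ + A₁E₂ + A₁A₂E₃ + … + A₁A₂⋯A_{d−1}E_d`, where `E_k` bounds the error of the `k`-th rule on the SECTIONS
`t ↦ f(…, t, …)` (all other variables real, anywhere in their intervals) and `A_k = Σ_j |a_{j,k}|` is the absolute
weight sum of the `k`-th rule; for the positive Gauss–Legendre weights `A_k = b_k − a_k`, so that for uniform section
errors the bound reads `Σ_k (Π_{j≠k} (b_j − a_j)) · E_k`.  For an integrand with a bounded holomorphic continuation IN
EACH VARIABLE SEPARATELY to the Bernstein ellipse `E_{ρ_k}` of `[a_k, b_k]` (the other variables real), `E_k` is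
Trefethen's `(b_k−a_k)/2 · 8M_k/((ρ_k−1)ρ_k^{2n_k+1})` for the `(n_k+1)`-point rule.  A CERTIFICATE needs
(i) certified `M_k` INCLUDING the holomorphy of the `d` families of continuations, (ii) certified nodes and weights of
the `d` rules, (iii) a rigorous evaluation of the `d`-fold sum — `Π_k (n_k+1)` integrand values — and (iv) the
measurability/integrability bookkeeping of the `d`-fold ITERATED integral.  This module supplies all four, for a code
list of integrands in the variables `x₀, x₁, …` over a box given as a LIST OF AXES, so that ONE `decide` proves
`∫…∫ f ∈ [lo, hi]` in any dimension.  Four parts: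

* Part A — SYNTAX, SEMANTICS, ENVIRONMENTS: `EN` (variables `var i`, rational constants, rational scaling, `+ − ×`,
  natural powers, `exp cos sin ⁻¹ √`), complex semantics `evalCN e : (ℕ → ℂ) → ℂ` (principal `√`), real semantics
  `evalRN e : (ℕ → ℝ) → ℝ`, measurability for the product σ-algebra (`measurable_evalRN`); the environment shift
  `scons x env` (`x` becomes variable `0`, variable `i` becomes `i + 1`) and its interplay with `Function.update`; an
  `Axis` (`lo hi rho deg cands`); the box predicate `InBox axes env` (coordinates beyond the list are `0`); the
  ITERATED INTEGRAL `iterI (ax :: rest) f = ∫_{lo}^{hi} iterI rest (f ∘ scons x) dx` and the PRODUCT RULE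
  `ruleN (ax :: rest) f = glRule deg lo hi (x ↦ ruleN rest (f ∘ scons x))` ((5.6.3), by recursion on the axes);
  the volume `volQ`; Haber's bound `errN axes k ε = Σ_i (Π_{j≠i} (hi_j − lo_j)) · ε (k + i)`.
* Part B — THE CERTIFIED MAJORANT IN `d` VARIABLES: the ellipse-bound arithmetic of the one-dimensional module run
  with a LIST of input boxes, `ebndN Bs e : EB` (variable `i` reads `Bs[i]`, default `realB 0 0`), side conditions
  `eokN` (reciprocals: `lb > 0`; radicands: `relo > 0`); ONE induction `ebndN_evalCN` gives the bound AND complex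
  differentiability in every variable; `evalCN_ofReal` (at real points the complex semantics is the real integrand);
  the box lists `realBoxes axes` (all variables real) and `secBoxes axes k` (variable `k` in Petras's rectangle
  `EB.varB ρ_k lo_k hi_k` around its ellipse, every other variable `j` in the degenerate box `realB lo_j hi_j`), their
  soundness `EBnd_realBoxes`, `EBnd_secBoxes`, and the uniform bound `abs_evalRN_le` of the integrand on the box.
* Part C — THE ERROR THEOREMS: linearity of `ruleN` (`ruleN_sub`, `ruleN_const_mul`, `ruleN_finset_sum`), the bounds
  `|ruleN axes g|, |iterI axes g| ≤ volQ · δ` (positive weights summing to the length; `‖∫‖ ≤ C·|b − a|`), the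
  measurability of `p ↦ ruleN axes (F p)` and of `p ↦ iterI axes (F p)` in a parameter (Fubini bookkeeping by
  `StronglyMeasurable.integral_prod_right'`), `∫ ruleN = ruleN ∫` (`integral_ruleN_comm`), the per-axis SECTION bound
  `abs_integral_sub_gl_le_axis` (the instance of `abs_integral_sub_gl_le_of` with the boxes `secBoxes axes k`; the
  rational error radius `epsQ axes e k`), and HABER'S ESTIMATE IN `d` DIMENSIONS `abs_iterI_sub_ruleN_le`:
  `|iterI axes f − ruleN axes f| ≤ errN axes 0 ε`, by induction on the axes — split `∫ iterI − glRule (ruleN)` at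
  `∫ ruleN`: the first difference is the induction hypothesis integrated over `[lo₀, hi₀]`, the second is `ruleN rest`
  (absolute weight sum `volQ rest`) applied to the axis-`0` section errors.
* Part D — THE KERNEL: value enclosures `Encl S xs XS`, the interval evaluator `evalIN` at a list of point enclosures
  (`mem_evalIN`), the folded level sum `levelSum` (`levelSum_mem`), the structurally recursive TENSOR SUM
  `tensor e S K k piI T axes XS` (axis by axis, appending the enclosure of the current node to `XS`; `tensor_mem`: it
  encloses `ruleN`, the accepted separated brackets of every axis being exactly the nodes of its rule by
  `axis_nodes`), the rational error radius `errQN`, the data `glDataN`, the Boolean CERTIFICATE `glCheckN` (integer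
  arithmetic only) and the MAIN THEOREM
  `integral_mem_of_glCheckN : glCheckN e axes S T K k lo hi = true → iterI axes (evalRN e) ∈ [lo, hi]`; SLICING of
  the outer axis (`intervalIntegrable_outer_of_glCheckN`, `integral_mem_of_glCheckN_split`: adjacent certified slices
  add up — one `decide` per slice, the way past the budget of one kernel evaluation); finally the self-contained
  `glCheckNS` (node candidates `glCands deg T` computed inside the check) with `integral_mem_of_glCheckNS`.

Parameters (chosen by the untrusted proposer; any values that pass are sound): per axis `rho` below the largest
ellipse parameter free of singularities of the sections AS SEEN BY THE MAJORANT CALCULUS (rectangles and corner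
hulls; every other variable ranges over its whole real interval), `deg` (the rule has `deg + 1` points; error
`∝ rho^{−2·deg}`), `cands` (the `deg + 1` node numerators at scale `T`, ascending, from `#eval glCands deg T`); the sum
scale `S ≈ 10^{digits+5}`; the bracket scale `T ≈ S · 2^{3·deg/2+10}`; `K` Taylor/Machin terms and `k` argument
halvings as in the one-dimensional module.  Kernel cost: `d` weight tables (`O(deg²)` interval operations each) and
`Π_k (deg_k + 1)` interval evaluations of the integrand (measured in the kernel: `≈ 90 ms` per point with one `exp` at
`112` bits, `≈ 6–10 ms` per rational point).  KERNEL BUDGET (measured, 2026-08-23): ONE `decide` comfortably carries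
`≈ 10³` points with an `exp` or `≈ 10⁴` rational points (`≈ 50–95 s`); a single certificate of `13³ = 2197`
`exp`-points (`ρ = 100`, `39` digits natively, data pass `16 s` under `#eval`) was REJECTED twice after `≈ 260 s` —
the kernel evaluation of that one declaration exhausting the checker's resources, not a false certificate (the same
integrand passes with `10³` points, and in `d = 2` with `13²`).  Larger boxes are therefore SLICED along the outer
axis, one `decide` per slice, the slices added by `integral_mem_of_glCheckN_split` (E2E (5)), or given lower degrees.

Worked end to end (scratch kept OUT of the tree, `Certquad.ScratchGaussLegendreND`; one farm node, (1) and (3)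
concurrent), each by ONE `decide +kernel` of `glCheckN` (node candidates pasted from `#eval glCands deg T`) followed
by `simp only [iterI, evalRN, scons_zero, scons_succ]; push_cast` to display the iterated integral:
(1) `d = 3`, `∫₀¹∫₀¹∫₀¹ e^{xyz} dz dy dx = Σ_{k≥0} 1/(k!(k+1)³) = 1.14649907252864280790119520246…` by `10³` points,
`ρ = 100` on every axis, `S = 2^112`, `T = 2^136`, `K = 18`, `k = 8`: width `4.8·10⁻²⁸` in `93 s`;
(2) `d = 3`, a reciprocal with pole set `xyz = −1`: `∫₀¹∫₀¹∫₀¹ dz dy dx/(1 + xyz) = (3/4)ζ(3) =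
0.9015426773696957140498036211…` by `20³ = 8000` points, `ρ = 5` (the box majorant certifies `|1 + xyz| ≥ 1/5`),
`S = 2^120`, `T = 2^160`: width `1.7·10⁻²⁶` in `88 s`; (3) `d = 4`, `∫_{[0,1]⁴} dV/(10 + w + x + y + z) =
(10³ ln 10 − 4·11³ ln 11 + 6·12³ ln 12 − 4·13³ ln 13 + 14³ ln 14)/6 = 0.08352745163215428429282756346…` (fourth
difference of `u³ ln u/6`) by `9⁴ = 6561` points, `ρ = 36`, `S = 2^100`, `T = 2^122`: width `2.2·10⁻²⁷` in `51 s`;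
(4) `d = 6`, `∫_{[0,1]⁶} (x₀ + … + x₅)² dV = 19/2` by the `2⁶ = 64`-point product of TWO-point rules — exact for
quadratics, so that `ρ = 10³⁰` drives Trefethen's bound below `10⁻⁶⁰`: width `3.2·10⁻⁶⁰` in `9 s` (`S = 2^210`);
(5) SLICED: `∫₀¹∫₀¹ (x + y)² dy dx = 7/6` from two certificates (`x ∈ [0, ½]`: `1/3`; `x ∈ [½, 1]`: `5/6`; two-point
rules, `ρ = 10²⁰`, `S = 2^140`) added by `integral_mem_of_glCheckN_split`: width `8.1·10⁻⁴¹` in `10 s`.  The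
100-digit reference values (power series, Apéry's series for `ζ(3)`, logarithms) lie inside every interval with
margins within `1 %` of half the width.

Honest framing.  These are shared numerical engines serving client cells; rigour lives in the verifiers (the
soundness theorems below, whose only hypothesis is a Boolean certificate decided by the kernel); every published
number belongs to a client cell's ledger, not to the engines group.  ANCHOR / nearest in-tree relatives:
`GaussLegendreCert` (USED: majorant atoms `EBnd.*`, `ell`, `ofRat`, `powI`, `glCands`), `GaussLegendreCert2D` (USED:
`realB`, `glRule`, `abs_integral_sub_gl_le_of`, `axisNW`, `axisTab`, `axis_nodes`; this module with `axes` of length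
`2` re-proves its theorem in the iterated form), `Quadrature.GaussLegendreAnalytic` (USED through the former: the
complex analysis), `MultiPrecisionInterval` / `PeriodicTrapezoidCert` (USED: `MI`/`MC` kernels, `sqrtI`, `invI`),
`TaylorModelIntegralCert3D` (the algebraic-order sibling over boxes in `d = 3`: Taylor models, no analyticity used),
`Quadrature.TensorProductRuleError` (the abstract `d`-fold tensor-rule recursion, NOT used: it needs the partial
integrals to be rule-approximable, i.e. holomorphy of parametric integrals; Haber's splitting below needs only the
sections, whose continuations the majorant calculus certifies variable by variable).  Nearest prior art in print:
product Gauss rules and Haber's estimate (Davis–Rabinowitz Sect. 5.6), the self-validating one-dimensional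
integrators of Petras and of Arb (Petras–Johansson), formally verified quadrature in Coq (CoqInterval: one variable);
no proof-kernel certificate for product Gauss–Legendre cubature in general dimension is known to us — here the `d`
node/weight tables, the `d` majorants with their holomorphy side conditions, the `d`-fold sum and the iterated Haber
bound are all re-certified inside the kernel, the error radius being a closed-form rational.  Deliberately NOT here:
non-box regions (generalized product rules, Sect. 5.6.1), adaptivity/bisection, sparse (Smolyak) grids, endpoint
singularities, the product-measure (Fubini) form of the statement, sharper majorants (true ellipse images), floating
point.  Problem-independent; no facts, no axioms; all certificate data computable over `ℚ` and `ℤ`.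

References: [cite: DavisRabinowitz1984, Sect. 5.6 (5.6.3)]; [cite: Trefethen2008, Thm. 4.5];
[cite: Petras2002, Sect. 3 (2)]; [cite: Petras2002, Sect. 5.1]; [cite: Johansson2018, Sect. 2];
[cite: JohanssonMezzarobba2018, Sect. 7.2]; [cite: Szego1939, Thm. 3.3.1]; [cite: Szego1939, Thm. 3.4.2];
[cite: CastilloPetronilho2024, Thm. 3.4]; [cite: Moore1979, Thm. 3.1]; [cite: Moore1979, Sect. 3.3];
[cite: Moore1979, Sect. 4.4 (4.11)]; [cite: Moore1979, Sect. 4.4 (4.12)]; [cite: MahboubiMelquiondSibutpinote2016, Sect. 4.1].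

AI-produced formalisation (H21 engines group, seat eng-quad-3 gen 64, 2026-08-23); no facts, no axioms, no `sorry`.
-/

open scoped Real Interval
open MeasureTheory intervalIntegral Set

namespace Literature.Analysis.ValidatedNumerics

namespace GaussLegendreND

open Literature.Analysis.ValidatedNumerics.NumericsMP
open Literature.Analysis.ValidatedNumerics.PeriodicTrapezoid (expUb sqrtI invI mem_sqrtI mem_invI)
open Literature.Analysis.ValidatedNumerics.GaussLegendre
open Literature.Analysis.ValidatedNumerics.GaussLegendre2D (realB EBnd_realB glRule node_mem_Icc
  weight_nonneg sum_weight abs_integral_sub_gl_le_of axisNW axisNW_spec axisTab axis_nodes)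
open Literature.Analysis.SpecialFunctions (legendre gaussLegendreNodes gaussLegendreWeight
  mem_Ioo_of_mem_gaussLegendreNodes gaussLegendreWeight_pos sum_gaussLegendreWeight)

/-! ### Part A. The integrand language in `d` variables: syntax, semantics, environments, the box -/

/-- The integrand language: expressions in the variables `var 0, var 1, …` built from rational constants by
rational scaling, `+ − ×`, natural powers, `exp cos sin`, reciprocal and (principal) square root — a code list in the
sense of interval analysis. [cite: Moore1979, Sect. 4.4 (4.11)] -/
inductive EN : Type
  | var (i : ℕ) : EN
  | const (c : ℚ) : EN
  | scale (q : ℚ) (e : EN) : EN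
  | add (e f : EN) : EN
  | sub (e f : EN) : EN
  | neg (e : EN) : EN
  | mul (e f : EN) : EN
  | pow (e : EN) (n : ℕ) : EN
  | exp (e : EN) : EN
  | cos (e : EN) : EN
  | sin (e : EN) : EN
  | inv (e : EN) : EN
  | sqrt (e : EN) : EN
  deriving Repr

/-- Complex semantics at a complex environment (the analytic continuations of the sections of the integrand;
`√` is the principal branch `w ^ (1/2)`). [cite: Trefethen2008, Thm. 4.5] -/
noncomputable def evalCN : EN → (ℕ → ℂ) → ℂ
  | .var i, env => env i
  | .const c, _ => (c : ℂ)
  | .scale q e, env => (q : ℂ) * evalCN e env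
  | .add e f, env => evalCN e env + evalCN f env
  | .sub e f, env => evalCN e env - evalCN f env
  | .neg e, env => -evalCN e env
  | .mul e f, env => evalCN e env * evalCN f env
  | .pow e n, env => evalCN e env ^ n
  | .exp e, env => Complex.exp (evalCN e env)
  | .cos e, env => Complex.cos (evalCN e env)
  | .sin e, env => Complex.sin (evalCN e env)
  | .inv e, env => (evalCN e env)⁻¹
  | .sqrt e, env => evalCN e env ^ (((1 : ℝ) / 2 : ℝ) : ℂ)

/-- Real semantics: the integrand `f(x₀, x₁, …)` at a real environment. [cite: DavisRabinowitz1984, Sect. 5.6 (5.6.3)] -/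
noncomputable def evalRN : EN → (ℕ → ℝ) → ℝ
  | .var i, env => env i
  | .const c, _ => (c : ℝ)
  | .scale q e, env => (q : ℝ) * evalRN e env
  | .add e f, env => evalRN e env + evalRN f env
  | .sub e f, env => evalRN e env - evalRN f env
  | .neg e, env => -evalRN e env
  | .mul e f, env => evalRN e env * evalRN f env
  | .pow e n, env => evalRN e env ^ n
  | .exp e, env => Real.exp (evalRN e env)
  | .cos e, env => Real.cos (evalRN e env)
  | .sin e, env => Real.sin (evalRN e env)
  | .inv e, env => (evalRN e env)⁻¹
  | .sqrt e, env => Real.sqrt (evalRN e env)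

/-- Measurability of the integrand for the product σ-algebra of `ℕ → ℝ` (the Fubini bookkeeping of the iterated
integral). [cite: DavisRabinowitz1984, Sect. 5.6 (5.6.3)] -/
theorem measurable_evalRN : ∀ e : EN, Measurable fun env : ℕ → ℝ => evalRN e env
  | .var i => measurable_pi_apply i
  | .const _ => measurable_const
  | .scale _ e => (measurable_evalRN e).const_mul _
  | .add e f => (measurable_evalRN e).add (measurable_evalRN f)
  | .sub e f => (measurable_evalRN e).sub (measurable_evalRN f)
  | .neg e => (measurable_evalRN e).neg
  | .mul e f => (measurable_evalRN e).mul (measurable_evalRN f)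
  | .pow e n => (measurable_evalRN e).pow_const n
  | .exp e => (measurable_evalRN e).exp
  | .cos e => (measurable_evalRN e).cos
  | .sin e => (measurable_evalRN e).sin
  | .inv e => (measurable_evalRN e).inv
  | .sqrt e => (measurable_evalRN e).sqrt

/-- The environment shift of the iterated integral: `x` becomes variable `0`, variable `i` becomes variable `i + 1`.
[cite: DavisRabinowitz1984, Sect. 5.6 (5.6.3)] -/
def scons {α : Type*} (x : α) (env : ℕ → α) : ℕ → α
  | 0 => x
  | i + 1 => env i

/-- [cite: DavisRabinowitz1984, Sect. 5.6 (5.6.3)] -/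
@[simp] theorem scons_zero {α : Type*} (x : α) (env : ℕ → α) : scons x env 0 = x := rfl

/-- [cite: DavisRabinowitz1984, Sect. 5.6 (5.6.3)] -/
@[simp] theorem scons_succ {α : Type*} (x : α) (env : ℕ → α) (i : ℕ) : scons x env (i + 1) = env i := rfl

/-- The shift is jointly measurable. [cite: DavisRabinowitz1984, Sect. 5.6 (5.6.3)] -/
theorem measurable_scons : Measurable fun p : ℝ × (ℕ → ℝ) => scons p.1 p.2 := by
  refine measurable_pi_iff.mpr (fun i => ?_)
  cases i with
  | zero => simpa only [scons_zero] using measurable_fst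
  | succ i =>
    simp only [scons_succ]
    exact (measurable_pi_apply i).comp measurable_snd

/-- [folklore] -/
private theorem measurable_scons_left (env : ℕ → ℝ) : Measurable fun x : ℝ => scons x env :=
  measurable_scons.comp (measurable_id.prodMk measurable_const)

/-- [folklore] -/
private theorem measurable_scons_right (x : ℝ) : Measurable (scons x : (ℕ → ℝ) → ℕ → ℝ) :=
  measurable_scons.comp (measurable_const.prodMk measurable_id)

/-- Updating variable `k + 1` of a shifted environment updates variable `k` of the tail.
[cite: DavisRabinowitz1984, Sect. 5.6 (5.6.3)] -/
theorem scons_update {α : Type*} (x : α) (env : ℕ → α) (k : ℕ) (t : α) :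
    Function.update (scons x env) (k + 1) t = scons x (Function.update env k t) := by
  funext i
  rcases i with _ | j
  · rw [Function.update_apply, if_neg (by omega)]
    rfl
  · rw [Function.update_apply, scons_succ, scons_succ, Function.update_apply]
    by_cases h : j = k
    · rw [if_pos (by omega), if_pos h]
    · rw [if_neg (by omega), if_neg h]

/-- Updating variable `0` of a shifted environment replaces the head. [cite: DavisRabinowitz1984, Sect. 5.6 (5.6.3)] -/
theorem update_scons_zero {α : Type*} (x : α) (env : ℕ → α) (t : α) :
    Function.update (scons x env) 0 t = scons t env := by
  funext i
  rcases i with _ | j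
  · rw [Function.update_self]
    rfl
  · rw [Function.update_of_ne (by omega : j + 1 ≠ 0)]
    rfl

/-- [folklore] -/
private theorem update_succ_succ {α : Type*} (f : ℕ → α) (k : ℕ) (z : α) (j : ℕ) :
    Function.update f (k + 1) z (j + 1) = Function.update (fun i => f (i + 1)) k z j := by
  rw [Function.update_apply, Function.update_apply]
  by_cases h : j = k
  · rw [if_pos (by omega), if_pos h]
  · rw [if_neg (by omega), if_neg h]

/-- One axis of the box: the interval `[lo, hi]`, the ellipse parameter `rho` of its sections, the rule degree
`deg` (the rule has `deg + 1` points) and the node candidates `cands` (numerators at the bracket scale `T`).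
[cite: DavisRabinowitz1984, Sect. 5.6 (5.6.3)] [cite: Petras2002, Sect. 5.1] -/
structure Axis where
  lo : ℚ
  hi : ℚ
  rho : ℚ
  deg : ℕ
  cands : List ℤ
  deriving Repr

/-- Axis `k` of the list (a degenerate default beyond it). [cite: DavisRabinowitz1984, Sect. 5.6 (5.6.3)] -/
def axAt (axes : List Axis) (k : ℕ) : Axis := axes.getD k ⟨0, 0, 0, 0, []⟩

/-- [cite: DavisRabinowitz1984, Sect. 5.6 (5.6.3)] -/
@[simp] theorem axAt_cons_zero (ax : Axis) (rest : List Axis) : axAt (ax :: rest) 0 = ax := rfl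

/-- [cite: DavisRabinowitz1984, Sect. 5.6 (5.6.3)] -/
@[simp] theorem axAt_cons_succ (ax : Axis) (rest : List Axis) (k : ℕ) :
    axAt (ax :: rest) (k + 1) = axAt rest k := rfl

/-- [folklore] -/
private theorem axAt_mem : ∀ {axes : List Axis} {k : ℕ}, k < axes.length → axAt axes k ∈ axes
  | [], _, h => absurd h (Nat.not_lt_zero _)
  | ax :: rest, 0, _ => by rw [axAt_cons_zero]; exact List.mem_cons_self
  | ax :: rest, k + 1, h => by
      rw [axAt_cons_succ]
      exact List.mem_cons_of_mem _ (axAt_mem (by simpa using h))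

/-- The box predicate: coordinate `i < d` lies in `[lo_i, hi_i]`, the coordinates beyond the list are `0` (so that
the innermost integrand is evaluated at a definite environment). [cite: DavisRabinowitz1984, Sect. 5.6 (5.6.3)] -/
def InBox : List Axis → (ℕ → ℝ) → Prop
  | [], env => env = fun _ => 0
  | ax :: rest, env => env 0 ∈ Icc (ax.lo : ℝ) ax.hi ∧ InBox rest (fun i => env (i + 1))

/-- [cite: DavisRabinowitz1984, Sect. 5.6 (5.6.3)] -/
theorem InBox_nil : InBox [] (fun _ => (0 : ℝ)) := rfl

/-- [cite: DavisRabinowitz1984, Sect. 5.6 (5.6.3)] -/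
theorem InBox_cons_iff {ax : Axis} {rest : List Axis} {env : ℕ → ℝ} :
    InBox (ax :: rest) env ↔ env 0 ∈ Icc (ax.lo : ℝ) ax.hi ∧ InBox rest (fun i => env (i + 1)) := Iff.rfl

/-- [cite: DavisRabinowitz1984, Sect. 5.6 (5.6.3)] -/
theorem InBox_scons {ax : Axis} {rest : List Axis} {x : ℝ} {env : ℕ → ℝ} (hx : x ∈ Icc (ax.lo : ℝ) ax.hi)
    (h : InBox rest env) : InBox (ax :: rest) (scons x env) :=
  InBox_cons_iff.mpr ⟨hx, h⟩

/-- Coordinates of a point of the box. [cite: DavisRabinowitz1984, Sect. 5.6 (5.6.3)] -/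
theorem InBox.mem_Icc : ∀ {axes : List Axis} {env : ℕ → ℝ}, InBox axes env → ∀ {k : ℕ}, k < axes.length →
    env k ∈ Icc ((axAt axes k).lo : ℝ) (axAt axes k).hi
  | [], _, _, _, hk => absurd hk (Nat.not_lt_zero _)
  | _ :: _, _, h, 0, _ => (InBox_cons_iff.mp h).1
  | _ :: rest, _, h, k + 1, hk =>
      InBox.mem_Icc (axes := rest) (InBox_cons_iff.mp h).2 (k := k) (by simpa using hk)

/-- **The iterated integral** over the box, outermost axis first:
`iterI (ax :: rest) f = ∫_{lo}^{hi} iterI rest (env ↦ f (scons x env)) dx`, `iterI [] f = f 0`.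
[cite: DavisRabinowitz1984, Sect. 5.6 (5.6.3)] -/
noncomputable def iterI : List Axis → ((ℕ → ℝ) → ℝ) → ℝ
  | [], f => f fun _ => 0
  | ax :: rest, f => ∫ x in (ax.lo : ℝ)..ax.hi, iterI rest fun env => f (scons x env)

/-- **The product Gauss–Legendre rule** ((5.6.3)), by the same recursion:
`ruleN (ax :: rest) f = glRule deg lo hi (x ↦ ruleN rest (env ↦ f (scons x env)))`.
[cite: DavisRabinowitz1984, Sect. 5.6 (5.6.3)] -/
noncomputable def ruleN : List Axis → ((ℕ → ℝ) → ℝ) → ℝ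
  | [], f => f fun _ => 0
  | ax :: rest, f => glRule ax.deg ax.lo ax.hi fun x => ruleN rest fun env => f (scons x env)

/-- The volume of the box (`= Π A_k`, the product of the absolute weight sums).
[cite: DavisRabinowitz1984, Sect. 5.6 (5.6.3)] -/
def volQ : List Axis → ℚ
  | [] => 1
  | ax :: rest => (ax.hi - ax.lo) * volQ rest

/-- [cite: DavisRabinowitz1984, Sect. 5.6 (5.6.3)] -/
theorem volQ_nonneg : ∀ {axes : List Axis}, (∀ ax ∈ axes, ax.lo ≤ ax.hi) → (0 : ℝ) ≤ (volQ axes : ℝ)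
  | [], _ => by simp [volQ]
  | ax :: rest, h => by
      simp only [volQ]
      push_cast
      exact mul_nonneg (sub_nonneg.mpr (by exact_mod_cast h ax (by simp)))
        (volQ_nonneg fun ax' h' => h ax' (List.mem_cons_of_mem _ h'))

/-- **Haber's bound** `E₁ + A₁E₂ + … + A₁⋯A_{d−1}E_d` with the trailing volumes made explicit:
`errN (ax :: rest) k ε = (hi − lo) · errN rest (k + 1) ε + volQ rest · ε k` — the section error `ε k` of axis `k`
weighted by the lengths of all other axes. [cite: DavisRabinowitz1984, Sect. 5.6 (5.6.3)] -/
noncomputable def errN : List Axis → ℕ → (ℕ → ℝ) → ℝ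
  | [], _, _ => 0
  | ax :: rest, k, ε => ((ax.hi : ℝ) - ax.lo) * errN rest (k + 1) ε + (volQ rest : ℝ) * ε k

/-- Index shift of Haber's bound. [cite: DavisRabinowitz1984, Sect. 5.6 (5.6.3)] -/
theorem errN_succ : ∀ (axes : List Axis) (k : ℕ) (ε : ℕ → ℝ),
    errN axes (k + 1) ε = errN axes k (fun j => ε (j + 1))
  | [], _, _ => rfl
  | ax :: rest, k, ε => by simp only [errN, errN_succ rest (k + 1) ε]

/-! ### Part B. The certified majorant in `d` variables -/

/-- Box `i` of the list (the degenerate box `realB 0 0` beyond it, matching `InBox`).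
[cite: Moore1979, Sect. 3.3] -/
def boxAt (Bs : List EB) (i : ℕ) : EB := Bs.getD i (realB 0 0)

/-- [cite: Moore1979, Sect. 3.3] -/
@[simp] theorem boxAt_cons_zero (B : EB) (Bs : List EB) : boxAt (B :: Bs) 0 = B := rfl

/-- [cite: Moore1979, Sect. 3.3] -/
@[simp] theorem boxAt_cons_succ (B : EB) (Bs : List EB) (i : ℕ) : boxAt (B :: Bs) (i + 1) = boxAt Bs i := rfl

/-- [cite: Moore1979, Sect. 3.3] -/
theorem boxAt_nil (i : ℕ) : boxAt [] i = realB 0 0 := by cases i <;> rfl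

/-- The ellipse data of an expression from the data of its variables, by structural recursion (the atoms are those
of the one-dimensional calculus). [cite: Moore1979, Sect. 4.4 (4.11)] -/
def ebndN (Bs : List EB) : EN → EB
  | .var i => boxAt Bs i
  | .const c => EB.constB c
  | .scale q e => EB.scaleB q (ebndN Bs e)
  | .add e f => EB.addB (ebndN Bs e) (ebndN Bs f)
  | .sub e f => EB.subB (ebndN Bs e) (ebndN Bs f)
  | .neg e => EB.negB (ebndN Bs e)
  | .mul e f => EB.mulB (ebndN Bs e) (ebndN Bs f)
  | .pow e n => EB.powB (ebndN Bs e) n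
  | .exp e => EB.expB (ebndN Bs e)
  | .cos e => EB.trigB (ebndN Bs e)
  | .sin e => EB.trigB (ebndN Bs e)
  | .inv e => EB.invB (ebndN Bs e)
  | .sqrt e => EB.sqrtB (ebndN Bs e)

/-- The side conditions making the continuations holomorphic: every reciprocal has a certified positive lower
bound of `|w|`, every radicand a certified positive lower bound of `Re w`. [cite: Petras2002, Sect. 3 (2)] -/
def eokN (Bs : List EB) : EN → Bool
  | .var _ => true
  | .const _ => true
  | .scale _ e => eokN Bs e
  | .add e f => eokN Bs e && eokN Bs f
  | .sub e f => eokN Bs e && eokN Bs f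
  | .neg e => eokN Bs e
  | .mul e f => eokN Bs e && eokN Bs f
  | .pow e _ => eokN Bs e
  | .exp e => eokN Bs e
  | .cos e => eokN Bs e
  | .sin e => eokN Bs e
  | .inv e => eokN Bs e && decide (0 < (ebndN Bs e).lb)
  | .sqrt e => eokN Bs e && decide (0 < (ebndN Bs e).relo)

/-- A point with certified positive `lb` is nonzero. [folklore] -/
private theorem ne_zero_of_lb_pos {z : ℂ} {A : EB} (hz : EBnd z A) (hlb : 0 < A.lb) : z ≠ 0 := by
  have hlb' : (0 : ℝ) < A.lb := by exact_mod_cast hlb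
  exact norm_pos_iff.mp (hlb'.trans_le hz.le_norm)

/-- A point with certified positive `relo` lies in the slit plane. [folklore] -/
private theorem mem_slitPlane_of_relo_pos {z : ℂ} {A : EB} (hz : EBnd z A) (h : 0 < A.relo) :
    z ∈ Complex.slitPlane := by
  have h' : (0 : ℝ) < A.relo := by exact_mod_cast h
  exact Complex.mem_slitPlane_iff.mpr (Or.inl (h'.trans_le hz.le_re))

/-- **Soundness of the majorant calculus in `d` variables.**  If the side conditions hold, then at every complex
environment satisfying the data of the variables, the value of every subexpression satisfies its ellipse data AND
the continuation is complex-differentiable in each variable separately (one induction).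
[cite: Moore1979, Thm. 3.1] [cite: Petras2002, Sect. 3 (2)] -/
theorem ebndN_evalCN {Bs : List EB} :
    ∀ (e : EN), eokN Bs e = true → ∀ env : ℕ → ℂ, (∀ i, EBnd (env i) (boxAt Bs i)) →
      EBnd (evalCN e env) (ebndN Bs e) ∧
        ∀ i, DifferentiableAt ℂ (fun u => evalCN e (Function.update env i u)) (env i) := by
  intro e
  induction e with
  | var j =>
    intro _ env henv
    refine ⟨?_, fun i => ?_⟩
    · simpa only [evalCN, ebndN] using henv j
    · simp only [evalCN]
      by_cases hji : j = i
      · subst hji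
        simp only [Function.update_self]
        exact differentiableAt_id
      · simp only [Function.update_of_ne hji]
        exact differentiableAt_const _
  | const c =>
    intro _ env _
    simp only [evalCN, ebndN]
    exact ⟨EBnd.const c, fun i => differentiableAt_const _⟩
  | scale q e ih =>
    intro hok env henv
    simp only [eokN] at hok
    have h1 := ih hok env henv
    simp only [evalCN, ebndN]
    exact ⟨h1.1.scale q, fun i => (h1.2 i).const_mul _⟩
  | add e f ihe ihf =>
    intro hok env henv
    simp only [eokN, Bool.and_eq_true] at hok
    have h1 := ihe hok.1 env henv
    have h2 := ihf hok.2 env henv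
    simp only [evalCN, ebndN]
    exact ⟨h1.1.add h2.1, fun i => (h1.2 i).add (h2.2 i)⟩
  | sub e f ihe ihf =>
    intro hok env henv
    simp only [eokN, Bool.and_eq_true] at hok
    have h1 := ihe hok.1 env henv
    have h2 := ihf hok.2 env henv
    simp only [evalCN, ebndN]
    exact ⟨h1.1.sub h2.1, fun i => (h1.2 i).sub (h2.2 i)⟩
  | neg e ih =>
    intro hok env henv
    simp only [eokN] at hok
    have h1 := ih hok env henv
    simp only [evalCN, ebndN]
    exact ⟨h1.1.neg, fun i => (h1.2 i).neg⟩
  | mul e f ihe ihf =>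
    intro hok env henv
    simp only [eokN, Bool.and_eq_true] at hok
    have h1 := ihe hok.1 env henv
    have h2 := ihf hok.2 env henv
    simp only [evalCN, ebndN]
    exact ⟨h1.1.mul h2.1, fun i => (h1.2 i).mul (h2.2 i)⟩
  | pow e n ih =>
    intro hok env henv
    simp only [eokN] at hok
    have h1 := ih hok env henv
    simp only [evalCN, ebndN]
    exact ⟨h1.1.pow n, fun i => (h1.2 i).pow n⟩
  | exp e ih =>
    intro hok env henv
    simp only [eokN] at hok
    have h1 := ih hok env henv
    simp only [evalCN, ebndN]
    exact ⟨h1.1.exp, fun i => (h1.2 i).cexp⟩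
  | cos e ih =>
    intro hok env henv
    simp only [eokN] at hok
    have h1 := ih hok env henv
    simp only [evalCN, ebndN]
    exact ⟨h1.1.cos, fun i => (h1.2 i).ccos⟩
  | sin e ih =>
    intro hok env henv
    simp only [eokN] at hok
    have h1 := ih hok env henv
    simp only [evalCN, ebndN]
    exact ⟨h1.1.sin, fun i => (h1.2 i).csin⟩
  | inv e ih =>
    intro hok env henv
    simp only [eokN, Bool.and_eq_true, decide_eq_true_eq] at hok
    have h1 := ih hok.1 env henv
    simp only [evalCN, ebndN]
    refine ⟨h1.1.inv hok.2, fun i => (h1.2 i).inv ?_⟩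
    show evalCN e (Function.update env i (env i)) ≠ 0
    rw [Function.update_eq_self]
    exact ne_zero_of_lb_pos h1.1 hok.2
  | sqrt e ih =>
    intro hok env henv
    simp only [eokN, Bool.and_eq_true, decide_eq_true_eq] at hok
    have h1 := ih hok.1 env henv
    simp only [evalCN, ebndN]
    refine ⟨h1.1.sqrt, fun i => (h1.2 i).cpow_const ?_⟩
    show evalCN e (Function.update env i (env i)) ∈ Complex.slitPlane
    rw [Function.update_eq_self]
    exact mem_slitPlane_of_relo_pos h1.1 hok.2

/-- The complexified real environment. [cite: Trefethen2008, Thm. 4.5] -/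
def cenv (env : ℕ → ℝ) : ℕ → ℂ := fun i => ((env i : ℝ) : ℂ)

/-- [cite: Trefethen2008, Thm. 4.5] -/
@[simp] theorem cenv_apply (env : ℕ → ℝ) (i : ℕ) : cenv env i = ((env i : ℝ) : ℂ) := rfl

/-- Updating a complexified environment at a real value. [cite: Trefethen2008, Thm. 4.5] -/
theorem cenv_update (env : ℕ → ℝ) (k : ℕ) (t : ℝ) :
    Function.update (cenv env) k (t : ℂ) = cenv (Function.update env k t) := by
  funext i
  by_cases h : i = k
  · subst h
    simp [Function.update_self]
  · simp [Function.update_of_ne h]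

/-- At real points satisfying the data, the complex semantics is the real integrand. [cite: Trefethen2008, Thm. 4.5] -/
theorem evalCN_ofReal {Bs : List EB} :
    ∀ (e : EN), eokN Bs e = true → ∀ env : ℕ → ℝ, (∀ i, EBnd (cenv env i) (boxAt Bs i)) →
      evalCN e (cenv env) = ((evalRN e env : ℝ) : ℂ) := by
  intro e
  induction e with
  | var i => intro _ env _; simp only [evalCN, evalRN, cenv_apply]
  | const c => intro _ env _; simp only [evalCN, evalRN]; push_cast; rfl
  | scale q e ih =>
    intro hok env henv
    simp only [eokN] at hok
    simp only [evalCN, evalRN, ih hok env henv]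
    push_cast
    rfl
  | add e f ihe ihf =>
    intro hok env henv
    simp only [eokN, Bool.and_eq_true] at hok
    simp only [evalCN, evalRN, ihe hok.1 env henv, ihf hok.2 env henv]
    push_cast
    rfl
  | sub e f ihe ihf =>
    intro hok env henv
    simp only [eokN, Bool.and_eq_true] at hok
    simp only [evalCN, evalRN, ihe hok.1 env henv, ihf hok.2 env henv]
    push_cast
    rfl
  | neg e ih =>
    intro hok env henv
    simp only [eokN] at hok
    simp only [evalCN, evalRN, ih hok env henv]
    push_cast
    rfl
  | mul e f ihe ihf =>
    intro hok env henv
    simp only [eokN, Bool.and_eq_true] at hok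
    simp only [evalCN, evalRN, ihe hok.1 env henv, ihf hok.2 env henv]
    push_cast
    rfl
  | pow e n ih =>
    intro hok env henv
    simp only [eokN] at hok
    simp only [evalCN, evalRN, ih hok env henv]
    push_cast
    rfl
  | exp e ih =>
    intro hok env henv
    simp only [eokN] at hok
    simp only [evalCN, evalRN, ih hok env henv]
    exact (Complex.ofReal_exp _).symm
  | cos e ih =>
    intro hok env henv
    simp only [eokN] at hok
    simp only [evalCN, evalRN, ih hok env henv]
    exact (Complex.ofReal_cos _).symm
  | sin e ih =>
    intro hok env henv
    simp only [eokN] at hok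
    simp only [evalCN, evalRN, ih hok env henv]
    exact (Complex.ofReal_sin _).symm
  | inv e ih =>
    intro hok env henv
    simp only [eokN, Bool.and_eq_true, decide_eq_true_eq] at hok
    simp only [evalCN, evalRN, ih hok.1 env henv]
    exact (Complex.ofReal_inv _).symm
  | sqrt e ih =>
    intro hok env henv
    simp only [eokN, Bool.and_eq_true, decide_eq_true_eq] at hok
    have hpos : 0 ≤ evalRN e env := by
      have h1 := (ebndN_evalCN e hok.1 (cenv env) henv).1.le_re
      rw [ih hok.1 env henv, Complex.ofReal_re] at h1
      have h2 : (0 : ℝ) < (ebndN Bs e).relo := by exact_mod_cast hok.2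
      linarith
    simp only [evalCN, evalRN, ih hok.1 env henv]
    rw [Real.sqrt_eq_rpow, Complex.ofReal_cpow hpos]

/-- The boxes of a REAL environment of the box: every variable in its degenerate box `realB lo hi`.
[cite: Moore1979, Sect. 3.3] -/
def realBoxes : List Axis → List EB
  | [] => []
  | ax :: rest => realB ax.lo ax.hi :: realBoxes rest

/-- The boxes of the SECTIONS in variable `k`: variable `k` in Petras's rectangle `EB.varB ρ_k lo_k hi_k` around
its ellipse, every other variable real. [cite: Petras2002, Sect. 3 (2)] [cite: Moore1979, Sect. 3.3] -/
def secBoxes : List Axis → ℕ → List EB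
  | [], _ => []
  | ax :: rest, 0 => EB.varB ax.rho ax.lo ax.hi :: realBoxes rest
  | ax :: rest, k + 1 => realB ax.lo ax.hi :: secBoxes rest k

/-- Soundness of `realBoxes`. [cite: Moore1979, Thm. 3.1] -/
theorem EBnd_realBoxes : ∀ (axes : List Axis) (env : ℕ → ℝ), InBox axes env →
    ∀ i, EBnd (cenv env i) (boxAt (realBoxes axes) i)
  | [], env, h, i => by
      have h0 : env = fun _ => 0 := h
      subst h0
      simpa [realBoxes, boxAt_nil] using EBnd_realB (c := 0) (d := 0) (t := (0 : ℝ)) (by simp)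
  | ax :: rest, env, h, 0 => by
      simpa [realBoxes] using EBnd_realB (InBox_cons_iff.mp h).1
  | ax :: rest, env, h, i + 1 => by
      simpa [realBoxes] using EBnd_realBoxes rest (fun j => env (j + 1)) (InBox_cons_iff.mp h).2 i

/-- Soundness of `secBoxes`: a real point of the box with coordinate `k` replaced by a point of the ellipse of axis
`k` satisfies the section data. [cite: Moore1979, Thm. 3.1] [cite: Petras2002, Sect. 3 (2)] -/
theorem EBnd_secBoxes : ∀ (axes : List Axis) (k : ℕ) (env : ℕ → ℝ) (z : ℂ), k < axes.length → InBox axes env →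
    1 < (axAt axes k).rho → (axAt axes k).lo < (axAt axes k).hi →
    z ∈ ell (axAt axes k).rho (axAt axes k).lo (axAt axes k).hi →
      ∀ i, EBnd (Function.update (cenv env) k z i) (boxAt (secBoxes axes k) i)
  | [], _, _, _, hk, _, _, _, _, _ => absurd hk (Nat.not_lt_zero _)
  | ax :: rest, 0, env, z, _, _, hρ, hab, hz, 0 => by
      simp only [axAt_cons_zero] at hρ hab hz
      rw [Function.update_self]
      simpa [secBoxes] using EBnd.var hρ hab hz
  | ax :: rest, 0, env, z, _, henv, _, _, _, i + 1 => by
      rw [Function.update_of_ne (by omega : i + 1 ≠ 0)]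
      simpa [secBoxes] using EBnd_realBoxes rest (fun j => env (j + 1)) (InBox_cons_iff.mp henv).2 i
  | ax :: rest, k + 1, env, z, _, henv, _, _, _, 0 => by
      rw [Function.update_of_ne (by omega : (0 : ℕ) ≠ k + 1)]
      simpa [secBoxes] using EBnd_realB (InBox_cons_iff.mp henv).1
  | ax :: rest, k + 1, env, z, hk, henv, hρ, hab, hz, i + 1 => by
      rw [update_succ_succ]
      exact EBnd_secBoxes rest k (fun j => env (j + 1)) z (by simpa using hk) (InBox_cons_iff.mp henv).2
        hρ hab hz i

/-- **The uniform bound of the integrand on the box** from the section data of any axis `k` (the real point has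
coordinate `k` on the segment of the ellipse of axis `k`). [cite: Trefethen2008, Thm. 4.5] -/
theorem abs_evalRN_le {e : EN} {axes : List Axis} {k : ℕ} (hk : k < axes.length)
    (hρ : 1 < (axAt axes k).rho) (hab : (axAt axes k).lo < (axAt axes k).hi)
    (hok : eokN (secBoxes axes k) e = true) {env : ℕ → ℝ} (henv : InBox axes env) :
    |evalRN e env| ≤ ((ebndN (secBoxes axes k) e).ub : ℝ) := by
  have hz : cenv env k ∈ ell (axAt axes k).rho (axAt axes k).lo (axAt axes k).hi :=
    ofReal_mem_ell hρ hab (henv.mem_Icc hk)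
  have hB := EBnd_secBoxes axes k env (cenv env k) hk henv hρ hab hz
  rw [Function.update_eq_self] at hB
  have h := (ebndN_evalCN e hok (cenv env) hB).1.norm_le
  rw [evalCN_ofReal e hok env hB, Complex.norm_real, Real.norm_eq_abs] at h
  exact h

/-! ### Part C. The error theorems: linearity and bounds of the rule, Fubini bookkeeping, Haber's estimate -/

/-- The product rule is linear: differences. [cite: DavisRabinowitz1984, Sect. 5.6 (5.6.3)] -/
theorem ruleN_sub : ∀ (axes : List Axis) (g h : (ℕ → ℝ) → ℝ),
    ruleN axes (fun env => g env - h env) = ruleN axes g - ruleN axes h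
  | [], g, h => by simp only [ruleN]
  | ax :: rest, g, h => by
      simp only [ruleN, glRule]
      rw [← Finset.sum_sub_distrib]
      refine Finset.sum_congr rfl (fun x _ => ?_)
      rw [ruleN_sub rest (fun env => g (scons (((ax.hi : ℝ) - ax.lo) / 2 * x + ((ax.lo : ℝ) + ax.hi) / 2) env))
        (fun env => h (scons (((ax.hi : ℝ) - ax.lo) / 2 * x + ((ax.lo : ℝ) + ax.hi) / 2) env))]
      ring

/-- The product rule is linear: constants. [cite: DavisRabinowitz1984, Sect. 5.6 (5.6.3)] -/
theorem ruleN_const_mul (c : ℝ) : ∀ (axes : List Axis) (g : (ℕ → ℝ) → ℝ),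
    ruleN axes (fun env => c * g env) = c * ruleN axes g
  | [], g => by simp only [ruleN]
  | ax :: rest, g => by
      simp only [ruleN, glRule]
      rw [Finset.mul_sum]
      refine Finset.sum_congr rfl (fun x _ => ?_)
      rw [ruleN_const_mul c rest
        (fun env => g (scons (((ax.hi : ℝ) - ax.lo) / 2 * x + ((ax.lo : ℝ) + ax.hi) / 2) env))]
      ring

/-- The product rule is linear: finite sums. [cite: DavisRabinowitz1984, Sect. 5.6 (5.6.3)] -/
theorem ruleN_finset_sum {ι : Type*} (s : Finset ι) : ∀ (axes : List Axis) (g : ι → (ℕ → ℝ) → ℝ),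
    ruleN axes (fun env => ∑ i ∈ s, g i env) = ∑ i ∈ s, ruleN axes (g i)
  | [], g => by simp only [ruleN]
  | ax :: rest, g => by
      simp only [ruleN, glRule]
      rw [Finset.sum_comm]
      refine Finset.sum_congr rfl (fun x _ => ?_)
      rw [ruleN_finset_sum s rest
        (fun i env => g i (scons (((ax.hi : ℝ) - ax.lo) / 2 * x + ((ax.lo : ℝ) + ax.hi) / 2) env)),
        Finset.mul_sum]

/-- **The product rule of a bounded function is bounded by `volume · bound`** (positive weights summing to the
lengths: `Σ|a_{j,k}| = A_k = b_k − a_k`). [cite: Szego1939, Thm. 3.4.2] [cite: CastilloPetronilho2024, Thm. 3.4] -/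
theorem abs_ruleN_le : ∀ (axes : List Axis) (g : (ℕ → ℝ) → ℝ) {δ : ℝ}, (∀ ax ∈ axes, ax.lo ≤ ax.hi) →
    (∀ env, InBox axes env → |g env| ≤ δ) → |ruleN axes g| ≤ (volQ axes : ℝ) * δ
  | [], g, δ, _, hg => by simpa [ruleN, volQ] using hg _ InBox_nil
  | ax :: rest, g, δ, hax, hg => by
      have hab : (ax.lo : ℝ) ≤ ax.hi := by exact_mod_cast hax ax (by simp)
      have haxr : ∀ ax' ∈ rest, ax'.lo ≤ ax'.hi := fun ax' h => hax ax' (List.mem_cons_of_mem _ h)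
      simp only [ruleN, glRule, volQ]
      push_cast
      refine (Finset.abs_sum_le_sum_abs _ _).trans ?_
      have hterm : ∀ x ∈ gaussLegendreNodes (ax.deg + 1),
          |((ax.hi : ℝ) - ax.lo) / 2 * gaussLegendreWeight (ax.deg + 1) x *
              ruleN rest (fun env =>
                g (scons (((ax.hi : ℝ) - ax.lo) / 2 * x + ((ax.lo : ℝ) + ax.hi) / 2) env))| ≤
            ((ax.hi : ℝ) - ax.lo) / 2 * gaussLegendreWeight (ax.deg + 1) x * ((volQ rest : ℝ) * δ) := by
        intro x hx
        rw [abs_mul, abs_of_nonneg (weight_nonneg hab hx)]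
        exact mul_le_mul_of_nonneg_left (abs_ruleN_le rest _ haxr
          (fun env henv => hg _ (InBox_scons (node_mem_Icc hab hx) henv))) (weight_nonneg hab hx)
      refine (Finset.sum_le_sum hterm).trans ?_
      rw [← Finset.sum_mul, sum_weight]
      exact le_of_eq (by ring)

/-- **The iterated integral of a bounded function is bounded by `volume · bound`** (`‖∫ₐᵇ g‖ ≤ C·|b − a|`, axis by
axis). [cite: DavisRabinowitz1984, Sect. 5.6 (5.6.3)] -/
theorem abs_iterI_le : ∀ (axes : List Axis) (g : (ℕ → ℝ) → ℝ) {δ : ℝ}, (∀ ax ∈ axes, ax.lo ≤ ax.hi) →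
    (∀ env, InBox axes env → |g env| ≤ δ) → |iterI axes g| ≤ (volQ axes : ℝ) * δ
  | [], g, δ, _, hg => by simpa [iterI, volQ] using hg _ InBox_nil
  | ax :: rest, g, δ, hax, hg => by
      have hab : (ax.lo : ℝ) ≤ ax.hi := by exact_mod_cast hax ax (by simp)
      have haxr : ∀ ax' ∈ rest, ax'.lo ≤ ax'.hi := fun ax' h => hax ax' (List.mem_cons_of_mem _ h)
      have hpt : ∀ x ∈ Ι (ax.lo : ℝ) ax.hi,
          ‖iterI rest (fun env => g (scons x env))‖ ≤ (volQ rest : ℝ) * δ := by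
        intro x hx
        rw [uIoc_of_le hab] at hx
        rw [Real.norm_eq_abs]
        exact abs_iterI_le rest _ haxr (fun env henv => hg _ (InBox_scons ⟨hx.1.le, hx.2⟩ henv))
      have := norm_integral_le_of_norm_le_const hpt
      rw [Real.norm_eq_abs, abs_of_nonneg (sub_nonneg.mpr hab)] at this
      simp only [iterI, volQ]
      push_cast
      have hvol : (0 : ℝ) ≤ (volQ rest : ℝ) := volQ_nonneg haxr
      nlinarith [this, hvol]

/-- **Measurability of the product rule in a parameter** (a finite sum of measurable functions).
[cite: DavisRabinowitz1984, Sect. 5.6 (5.6.3)] -/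
theorem measurable_ruleN_param : ∀ (axes : List Axis) {β : Type} [MeasurableSpace β]
    (F : β → (ℕ → ℝ) → ℝ), Measurable (fun q : β × (ℕ → ℝ) => F q.1 q.2) →
      Measurable fun p => ruleN axes (F p)
  | [], β, _, F, hF => by
      simp only [ruleN]
      exact hF.comp (measurable_id.prodMk measurable_const)
  | ax :: rest, β, _, F, hF => by
      simp only [ruleN, glRule]
      refine Finset.measurable_sum _ (fun x _ => ?_)
      refine Measurable.const_mul ?_ _
      exact measurable_ruleN_param rest
        (fun p env => F p (scons (((ax.hi : ℝ) - ax.lo) / 2 * x + ((ax.lo : ℝ) + ax.hi) / 2) env))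
        (hF.comp (measurable_fst.prodMk ((measurable_scons_right _).comp measurable_snd)))

/-- **Measurability of the iterated integral in a parameter** (Fubini bookkeeping: the integral of a jointly
measurable function against an s-finite measure is measurable in the parameter, axis by axis).
[cite: DavisRabinowitz1984, Sect. 5.6 (5.6.3)] -/
theorem measurable_iterI_param : ∀ (axes : List Axis) {β : Type} [MeasurableSpace β]
    (F : β → (ℕ → ℝ) → ℝ), Measurable (fun q : β × (ℕ → ℝ) => F q.1 q.2) →
      Measurable fun p => iterI axes (F p)
  | [], β, _, F, hF => by
      simp only [iterI]
      exact hF.comp (measurable_id.prodMk measurable_const)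
  | ax :: rest, β, _, F, hF => by
      have ih : Measurable fun q : β × ℝ => iterI rest fun env => F q.1 (scons q.2 env) :=
        measurable_iterI_param rest (fun (q : β × ℝ) env => F q.1 (scons q.2 env))
          (hF.comp ((measurable_fst.comp measurable_fst).prodMk
            (measurable_scons.comp ((measurable_snd.comp measurable_fst).prodMk measurable_snd))))
      have h1 := (ih.stronglyMeasurable.integral_prod_right'
        (ν := volume.restrict (Ioc (ax.lo : ℝ) ax.hi))).measurable
      have h2 := (ih.stronglyMeasurable.integral_prod_right'
        (ν := volume.restrict (Ioc (ax.hi : ℝ) ax.lo))).measurable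
      simp only [iterI, intervalIntegral]
      exact h1.sub h2

/-- A measurable function bounded on `[a, b]` is interval integrable there. [folklore] -/
private theorem intervalIntegrable_of_bdd {g : ℝ → ℝ} (hg : Measurable g) {a b M : ℝ} (hab : a ≤ b)
    (hb : ∀ x ∈ Icc a b, |g x| ≤ M) : IntervalIntegrable g volume a b := by
  rw [intervalIntegrable_iff_integrableOn_Icc_of_le hab]
  refine Measure.integrableOn_of_bounded (M := M)
    (by rw [Real.volume_Icc]; exact ENNReal.ofReal_ne_top) hg.aestronglyMeasurable ?_
  refine (ae_restrict_iff' measurableSet_Icc).2 (Filter.Eventually.of_forall fun x hx => ?_)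
  rw [Real.norm_eq_abs]
  exact hb x hx

/-- The product rule of interval integrable sections is interval integrable in the parameter.
[cite: DavisRabinowitz1984, Sect. 5.6 (5.6.3)] -/
theorem intervalIntegrable_ruleN_param : ∀ (axes : List Axis) (g : ℝ → (ℕ → ℝ) → ℝ) {a b : ℝ},
    (∀ ax ∈ axes, ax.lo ≤ ax.hi) →
    (∀ env, InBox axes env → IntervalIntegrable (fun x => g x env) volume a b) →
      IntervalIntegrable (fun x => ruleN axes (g x)) volume a b
  | [], g, a, b, _, hg => by simpa [ruleN] using hg _ InBox_nil
  | ax :: rest, g, a, b, hax, hg => by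
      have hab : (ax.lo : ℝ) ≤ ax.hi := by exact_mod_cast hax ax (by simp)
      have haxr : ∀ ax' ∈ rest, ax'.lo ≤ ax'.hi := fun ax' h => hax ax' (List.mem_cons_of_mem _ h)
      have h1 := IntervalIntegrable.sum (μ := volume) (a := a) (b := b) (gaussLegendreNodes (ax.deg + 1))
        (f := fun i x => ((ax.hi : ℝ) - ax.lo) / 2 * gaussLegendreWeight (ax.deg + 1) i *
          ruleN rest (fun env => g x (scons (((ax.hi : ℝ) - ax.lo) / 2 * i + ((ax.lo : ℝ) + ax.hi) / 2) env)))
        (fun i hi => (intervalIntegrable_ruleN_param rest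
          (fun x env => g x (scons (((ax.hi : ℝ) - ax.lo) / 2 * i + ((ax.lo : ℝ) + ax.hi) / 2) env)) haxr
          (fun env henv => hg _ (InBox_scons (node_mem_Icc hab hi) henv))).const_mul _)
      rw [Finset.sum_fn] at h1
      simpa only [ruleN, glRule] using h1

/-- **The integral of the product rule is the product rule of the integrals** (finite sums and constants commute
with `∫`). [cite: DavisRabinowitz1984, Sect. 5.6 (5.6.3)] -/
theorem integral_ruleN_comm : ∀ (axes : List Axis) (g : ℝ → (ℕ → ℝ) → ℝ) {a b : ℝ},
    (∀ ax ∈ axes, ax.lo ≤ ax.hi) →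
    (∀ env, InBox axes env → IntervalIntegrable (fun x => g x env) volume a b) →
      (∫ x in a..b, ruleN axes (g x)) = ruleN axes (fun env => ∫ x in a..b, g x env)
  | [], g, a, b, _, _ => by simp only [ruleN]
  | ax :: rest, g, a, b, hax, hg => by
      have hab : (ax.lo : ℝ) ≤ ax.hi := by exact_mod_cast hax ax (by simp)
      have haxr : ∀ ax' ∈ rest, ax'.lo ≤ ax'.hi := fun ax' h => hax ax' (List.mem_cons_of_mem _ h)
      simp only [ruleN, glRule]
      have hint : ∀ i ∈ gaussLegendreNodes (ax.deg + 1), IntervalIntegrable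
          (fun x => ((ax.hi : ℝ) - ax.lo) / 2 * gaussLegendreWeight (ax.deg + 1) i *
            ruleN rest (fun env => g x (scons (((ax.hi : ℝ) - ax.lo) / 2 * i + ((ax.lo : ℝ) + ax.hi) / 2) env)))
          volume a b := fun i hi =>
        (intervalIntegrable_ruleN_param rest
          (fun x env => g x (scons (((ax.hi : ℝ) - ax.lo) / 2 * i + ((ax.lo : ℝ) + ax.hi) / 2) env)) haxr
          (fun env henv => hg _ (InBox_scons (node_mem_Icc hab hi) henv))).const_mul _
      rw [intervalIntegral.integral_finsetSum hint]
      refine Finset.sum_congr rfl (fun i hi => ?_)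
      rw [intervalIntegral.integral_const_mul,
        integral_ruleN_comm rest
          (fun x env => g x (scons (((ax.hi : ℝ) - ax.lo) / 2 * i + ((ax.lo : ℝ) + ax.hi) / 2) env)) haxr
          (fun env henv => hg _ (InBox_scons (node_mem_Icc hab hi) henv))]

/-- The certified SECTION error radius of axis `k`: Trefethen's `(hi−lo)/2 · 8M/((ρ−1)ρ^{2·deg+1})` with the
majorant `M = (ebndN (secBoxes axes k) e).ub`, a rational. [cite: Trefethen2008, Thm. 4.5] -/
def epsQ (axes : List Axis) (e : EN) (k : ℕ) : ℚ :=
  ((axAt axes k).hi - (axAt axes k).lo) / 2 *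
    (8 * (ebndN (secBoxes axes k) e).ub /
      (((axAt axes k).rho - 1) * (axAt axes k).rho ^ (2 * ((axAt axes k).deg + 1) - 1)))

/-- **The section bound of axis `k`**: at every real point of the box, the rule of axis `k` integrates the section
`t ↦ f(env[k ↦ t])` to within `epsQ axes e k` (Trefethen's bound for the continuation certified by the boxes
`secBoxes axes k`). [cite: Trefethen2008, Thm. 4.5] [cite: Petras2002, Sect. 3 (2)] -/
theorem abs_integral_sub_gl_le_axis {e : EN} {axes : List Axis} {k : ℕ} (hk : k < axes.length)
    (hρ : 1 < (axAt axes k).rho) (hab : (axAt axes k).lo < (axAt axes k).hi)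
    (hok : eokN (secBoxes axes k) e = true) {env : ℕ → ℝ} (henv : InBox axes env) :
    |(∫ t in ((axAt axes k).lo : ℝ)..(axAt axes k).hi, evalRN e (Function.update env k t)) -
        glRule (axAt axes k).deg (axAt axes k).lo (axAt axes k).hi
          (fun t => evalRN e (Function.update env k t))| ≤ ((epsQ axes e k : ℚ) : ℝ) := by
  have hρ1 : (1 : ℝ) < (axAt axes k).rho := by exact_mod_cast hρ
  have hab' : ((axAt axes k).lo : ℝ) < (axAt axes k).hi := by exact_mod_cast hab
  have hB : ∀ z ∈ ell (axAt axes k).rho (axAt axes k).lo (axAt axes k).hi,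
      ∀ i, EBnd (Function.update (cenv env) k z i) (boxAt (secBoxes axes k) i) :=
    fun z hz => EBnd_secBoxes axes k env z hk henv hρ hab hz
  have heq : ((epsQ axes e k : ℚ) : ℝ) = (((axAt axes k).hi : ℝ) - (axAt axes k).lo) / 2 *
      (8 * ((ebndN (secBoxes axes k) e).ub : ℝ) /
        ((((axAt axes k).rho : ℝ) - 1) * ((axAt axes k).rho : ℝ) ^ (2 * ((axAt axes k).deg + 1) - 1))) := by
    simp only [epsQ, Rat.cast_mul, Rat.cast_div, Rat.cast_sub, Rat.cast_pow, Rat.cast_ofNat, Rat.cast_one]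
  rw [heq]
  refine abs_integral_sub_gl_le_of (F := fun z => evalCN e (Function.update (cenv env) k z)) hρ1 hab'
    ?_ ?_ ?_ (axAt axes k).deg
  · intro z hz
    have hd := (ebndN_evalCN e hok _ (hB z hz)).2 k
    simp only [Function.update_idem, Function.update_self] at hd
    exact hd.differentiableWithinAt
  · intro z hz
    exact (ebndN_evalCN e hok _ (hB z hz)).1.norm_le
  · intro t ht
    have hzt := hB _ (ofReal_mem_ell hρ hab ht)
    rw [cenv_update] at hzt
    show evalCN e (Function.update (cenv env) k (t : ℂ)) = ((evalRN e (Function.update env k t) : ℝ) : ℂ)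
    rw [cenv_update]
    exact evalCN_ofReal e hok _ hzt

/-! #### Haber's error estimate for the product rule in `d` dimensions -/

/-- **Haber's error estimate for a product rule, general `d`.**  If, for every axis `k` and every real point of
the box, the rule of axis `k` integrates the section in variable `k` to within `ε k`, and `f` is measurable and
bounded on the box, then the product rule `Π_k Q_k` ((5.6.3)) integrates `f` over the box to within
`errN axes 0 ε = E₁ + A₁E₂ + … + A₁⋯A_{d−1}E_d` (with `E_k = (Π_{j>k} A_j) ε_k`, `A_j = hi_j − lo_j` for the positive
Gauss–Legendre weights), the integral being the iterated one. [cite: DavisRabinowitz1984, Sect. 5.6 (5.6.3)] -/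
theorem abs_iterI_sub_ruleN_le : ∀ (axes : List Axis) (f : (ℕ → ℝ) → ℝ) (ε : ℕ → ℝ) (M : ℝ),
    (∀ ax ∈ axes, ax.lo < ax.hi) → Measurable f → (∀ env, InBox axes env → |f env| ≤ M) →
    (∀ k < axes.length, ∀ env, InBox axes env →
      |(∫ t in ((axAt axes k).lo : ℝ)..(axAt axes k).hi, f (Function.update env k t)) -
          glRule (axAt axes k).deg (axAt axes k).lo (axAt axes k).hi (fun t => f (Function.update env k t))| ≤
        ε k) →
      |iterI axes f - ruleN axes f| ≤ errN axes 0 ε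
  | [], f, ε, M, _, _, _, _ => by simp [iterI, ruleN, errN]
  | ax :: rest, f, ε, M, hax, hf, hM, hsec => by
    have hab0 : ax.lo < ax.hi := hax ax (by simp)
    have hab : (ax.lo : ℝ) ≤ ax.hi := by exact_mod_cast hab0.le
    have haxr : ∀ ax' ∈ rest, ax'.lo < ax'.hi := fun ax' h => hax ax' (List.mem_cons_of_mem _ h)
    have haxr' : ∀ ax' ∈ rest, ax'.lo ≤ ax'.hi := fun ax' h => (haxr ax' h).le
    have hfx : ∀ x : ℝ, Measurable fun env => f (scons x env) := fun x => hf.comp (measurable_scons_right x)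
    have hMx : ∀ x ∈ Icc (ax.lo : ℝ) ax.hi, ∀ env, InBox rest env → |f (scons x env)| ≤ M :=
      fun x hx env henv => hM _ (InBox_scons hx henv)
    -- the induction hypothesis on every slice
    have hIH : ∀ x ∈ Icc (ax.lo : ℝ) ax.hi,
        |iterI rest (fun env => f (scons x env)) - ruleN rest (fun env => f (scons x env))| ≤
          errN rest 0 (fun j => ε (j + 1)) := by
      intro x hx
      refine abs_iterI_sub_ruleN_le rest (fun env => f (scons x env)) (fun j => ε (j + 1)) M haxr (hfx x)
        (hMx x hx) ?_
      intro k hk env henv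
      have h := hsec (k + 1) (by simpa using hk) (scons x env) (InBox_scons hx henv)
      simpa only [axAt_cons_succ, scons_update] using h
    -- measurability, bounds, integrability of the two slice functions
    have hFm : Measurable fun q : ℝ × (ℕ → ℝ) => f (scons q.1 q.2) := hf.comp measurable_scons
    have hAm : Measurable fun x => iterI rest (fun env => f (scons x env)) :=
      measurable_iterI_param rest (fun x env => f (scons x env)) hFm
    have hBm : Measurable fun x => ruleN rest (fun env => f (scons x env)) :=
      measurable_ruleN_param rest (fun x env => f (scons x env)) hFm
    have hAi : IntervalIntegrable (fun x => iterI rest (fun env => f (scons x env))) volume ax.lo ax.hi :=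
      intervalIntegrable_of_bdd hAm hab (fun x hx => abs_iterI_le rest _ haxr' (hMx x hx))
    have hBi : IntervalIntegrable (fun x => ruleN rest (fun env => f (scons x env))) volume ax.lo ax.hi :=
      intervalIntegrable_of_bdd hBm hab (fun x hx => abs_ruleN_le rest _ haxr' (hMx x hx))
    -- Step 1: the induction hypothesis, integrated over the outer axis
    have h1 : |(∫ x in (ax.lo : ℝ)..ax.hi, iterI rest (fun env => f (scons x env))) -
        ∫ x in (ax.lo : ℝ)..ax.hi, ruleN rest (fun env => f (scons x env))| ≤
          ((ax.hi : ℝ) - ax.lo) * errN rest 0 (fun j => ε (j + 1)) := by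
      rw [← intervalIntegral.integral_sub hAi hBi]
      have hpt : ∀ x ∈ Ι (ax.lo : ℝ) ax.hi,
          ‖iterI rest (fun env => f (scons x env)) - ruleN rest (fun env => f (scons x env))‖ ≤
            errN rest 0 (fun j => ε (j + 1)) := by
        intro x hx
        rw [uIoc_of_le hab] at hx
        rw [Real.norm_eq_abs]
        exact hIH x ⟨hx.1.le, hx.2⟩
      have := norm_integral_le_of_norm_le_const hpt
      rw [Real.norm_eq_abs, abs_of_nonneg (sub_nonneg.mpr hab)] at this
      linarith
    -- Step 2: the outer rule applied to the axis-0 section errors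
    have hsec0 : ∀ env, InBox rest env →
        |(∫ x in (ax.lo : ℝ)..ax.hi, f (scons x env)) - glRule ax.deg ax.lo ax.hi (fun x => f (scons x env))| ≤
          ε 0 := by
      intro env henv
      have h := hsec 0 (by simp) (scons (ax.lo : ℝ) env) (InBox_scons ⟨le_rfl, hab⟩ henv)
      simpa only [axAt_cons_zero, update_scons_zero] using h
    have hfi : ∀ env, InBox rest env → IntervalIntegrable (fun x => f (scons x env)) volume ax.lo ax.hi :=
      fun env henv => intervalIntegrable_of_bdd (hf.comp (measurable_scons_left env)) hab
        (fun x hx => hMx x hx env henv)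
    have e1 : (∫ x in (ax.lo : ℝ)..ax.hi, ruleN rest (fun env => f (scons x env))) =
        ruleN rest (fun env => ∫ x in (ax.lo : ℝ)..ax.hi, f (scons x env)) :=
      integral_ruleN_comm rest (fun x env => f (scons x env)) haxr' hfi
    have e2 : glRule ax.deg ax.lo ax.hi (fun x => ruleN rest (fun env => f (scons x env))) =
        ruleN rest (fun env => glRule ax.deg ax.lo ax.hi (fun x => f (scons x env))) := by
      simp only [glRule]
      rw [ruleN_finset_sum]
      refine Finset.sum_congr rfl (fun x _ => ?_)
      rw [ruleN_const_mul]
    have h3 : |(∫ x in (ax.lo : ℝ)..ax.hi, ruleN rest (fun env => f (scons x env))) -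
        glRule ax.deg ax.lo ax.hi (fun x => ruleN rest (fun env => f (scons x env)))| ≤
          (volQ rest : ℝ) * ε 0 := by
      rw [e1, e2, ← ruleN_sub]
      exact abs_ruleN_le rest _ haxr' hsec0
    -- assemble
    have hsplit : iterI (ax :: rest) f - ruleN (ax :: rest) f =
        ((∫ x in (ax.lo : ℝ)..ax.hi, iterI rest (fun env => f (scons x env))) -
            ∫ x in (ax.lo : ℝ)..ax.hi, ruleN rest (fun env => f (scons x env))) +
          ((∫ x in (ax.lo : ℝ)..ax.hi, ruleN rest (fun env => f (scons x env))) -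
            glRule ax.deg ax.lo ax.hi (fun x => ruleN rest (fun env => f (scons x env)))) := by
      simp only [iterI, ruleN]
      ring
    rw [hsplit, errN, errN_succ]
    exact (abs_add_le _ _).trans (add_le_add h1 h3)

/-! ### Part D. The interval kernel: the tensor sum, the error radius, the certificate -/

/-- Enclosures of a list of real values (the transported nodes of the outer axes, outermost LAST so that the head
of the environment is appended last). [cite: Moore1979, Thm. 3.1] -/
def Encl (S : ℕ) : List ℝ → List MI → Prop
  | [], [] => True
  | x :: xs, X :: XS => MI.mem S x X ∧ Encl S xs XS
  | [], _ :: _ => False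
  | _ :: _, [] => False

/-- [cite: Moore1979, Thm. 3.1] -/
theorem Encl.nil (S : ℕ) : Encl S ([] : List ℝ) [] := trivial

/-- Appending one enclosed value. [cite: Moore1979, Thm. 3.1] -/
theorem Encl.snoc {S : ℕ} : ∀ {xs : List ℝ} {XS : List MI}, Encl S xs XS → ∀ {x : ℝ} {X : MI},
    MI.mem S x X → Encl S (xs ++ [x]) (XS ++ [X])
  | [], [], _, x, X, hx => by simpa [Encl] using hx
  | y :: ys, Y :: YS, h, x, X, hx => by
      simp only [Encl] at h
      simp only [List.cons_append, Encl]
      exact ⟨h.1, Encl.snoc h.2 hx⟩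
  | [], _ :: _, h, _, _, _ => by simp [Encl] at h
  | _ :: _, [], h, _, _, _ => by simp [Encl] at h

/-- Reading an enclosed value: entry `i` encloses coordinate `i` of the environment `xs.foldr scons env₀`.
[cite: Moore1979, Thm. 3.1] -/
theorem Encl.get {S : ℕ} (env₀ : ℕ → ℝ) : ∀ {xs : List ℝ} {XS : List MI}, Encl S xs XS →
    ∀ {i : ℕ} {Z : MI}, XS[i]? = some Z → MI.mem S (xs.foldr scons env₀ i) Z
  | [], [], _, i, Z, h => by simp at h
  | x :: xs, X :: XS, h, 0, Z, hZ => by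
      simp only [Encl] at h
      simp only [List.getElem?_cons_zero, Option.some.injEq] at hZ
      subst hZ
      simpa [List.foldr_cons] using h.1
  | x :: xs, X :: XS, h, i + 1, Z, hZ => by
      simp only [Encl] at h
      simp only [List.getElem?_cons_succ] at hZ
      simpa [List.foldr_cons] using Encl.get env₀ h.2 hZ
  | [], _ :: _, h, _, _, _ => by simp [Encl] at h
  | _ :: _, [], h, _, _, _ => by simp [Encl] at h

/-- **The interval evaluator** of the integrand at a real point whose coordinates are enclosed by the list `XS`
(scale `S`, Taylor parameters `K, k`, `piI ∋ π` for the argument reduction of `cos`, `sin`): an enclosure of the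
value (`none` if a variable is missing, a reciprocal or square root cannot be certified, or a kernel declines).
[cite: Moore1979, Sect. 4.4 (4.12)] -/
def evalIN (S K k : ℕ) (piI : MI) (XS : List MI) : EN → Option MI
  | .var i => XS[i]?
  | .const c => some (ofRat S c)
  | .scale q e =>
    match evalIN S K k piI XS e with
    | some A => some (MI.mul S (ofRat S q) A)
    | none => none
  | .add e f =>
    match evalIN S K k piI XS e, evalIN S K k piI XS f with
    | some A, some B => some (A.add B)
    | _, _ => none
  | .sub e f =>
    match evalIN S K k piI XS e, evalIN S K k piI XS f with
    | some A, some B => some (A.sub B)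
    | _, _ => none
  | .neg e =>
    match evalIN S K k piI XS e with
    | some A => some A.neg
    | none => none
  | .mul e f =>
    match evalIN S K k piI XS e, evalIN S K k piI XS f with
    | some A, some B => some (MI.mul S A B)
    | _, _ => none
  | .pow e n =>
    match evalIN S K k piI XS e with
    | some A => some (powI S A n)
    | none => none
  | .exp e =>
    match evalIN S K k piI XS e with
    | some A => MI.exp S K k A
    | none => none
  | .cos e =>
    match evalIN S K k piI XS e with
    | some A =>
      match MC.expI S K k piI A with
      | some W => some W.re
      | none => none
    | none => none
  | .sin e =>
    match evalIN S K k piI XS e with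
    | some A =>
      match MC.expI S K k piI A with
      | some W => some W.im
      | none => none
    | none => none
  | .inv e =>
    match evalIN S K k piI XS e with
    | some A => invI S A
    | none => none
  | .sqrt e =>
    match evalIN S K k piI XS e with
    | some A => sqrtI S A
    | none => none

/-- **Soundness of the interval evaluator.** [cite: Moore1979, Thm. 3.1] -/
theorem mem_evalIN {S K k : ℕ} (hS : 0 < S) {piI : MI} (hpi : MI.mem S Real.pi piI) {xs : List ℝ}
    {XS : List MI} (hxs : Encl S xs XS) :
    ∀ (e : EN) {Z : MI}, evalIN S K k piI XS e = some Z →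
      MI.mem S (evalRN e (xs.foldr scons (fun _ => 0))) Z := by
  intro e
  induction e with
  | var i =>
    intro Z h
    simp only [evalIN] at h
    simpa [evalRN] using hxs.get (fun _ => 0) h
  | const c =>
    intro Z h
    simp only [evalIN, Option.some.injEq] at h
    subst h
    simpa [evalRN] using mem_ofRat S c
  | scale q e ih =>
    intro Z h
    simp only [evalIN] at h
    split at h
    · rename_i A hA
      simp only [Option.some.injEq] at h
      subst h
      simpa [evalRN] using MI.mem_mul hS (mem_ofRat S q) (ih hA)
    · simp at h
  | add e f ihe ihf =>
    intro Z h
    simp only [evalIN] at h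
    split at h
    · rename_i A B hA hB
      simp only [Option.some.injEq] at h
      subst h
      exact MI.mem_add (ihe hA) (ihf hB)
    · simp at h
  | sub e f ihe ihf =>
    intro Z h
    simp only [evalIN] at h
    split at h
    · rename_i A B hA hB
      simp only [Option.some.injEq] at h
      subst h
      exact MI.mem_sub (ihe hA) (ihf hB)
    · simp at h
  | neg e ih =>
    intro Z h
    simp only [evalIN] at h
    split at h
    · rename_i A hA
      simp only [Option.some.injEq] at h
      subst h
      exact MI.mem_neg (ih hA)
    · simp at h
  | mul e f ihe ihf =>
    intro Z h
    simp only [evalIN] at h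
    split at h
    · rename_i A B hA hB
      simp only [Option.some.injEq] at h
      subst h
      exact MI.mem_mul hS (ihe hA) (ihf hB)
    · simp at h
  | pow e n ih =>
    intro Z h
    simp only [evalIN] at h
    split at h
    · rename_i A hA
      simp only [Option.some.injEq] at h
      subst h
      exact mem_powI hS (ih hA) n
    · simp at h
  | exp e ih =>
    intro Z h
    simp only [evalIN] at h
    split at h
    · rename_i A hA
      exact MI.mem_exp hS h (ih hA)
    · simp at h
  | cos e ih =>
    intro Z h
    simp only [evalIN] at h
    split at h
    · rename_i A hA
      split at h
      · rename_i W hW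
        simp only [Option.some.injEq] at h
        subst h
        have h1 := (MC.mem_expI hS hpi hW (ih hA)).1
        rw [Complex.exp_ofReal_mul_I_re] at h1
        simpa [evalRN] using h1
      · simp at h
    · simp at h
  | sin e ih =>
    intro Z h
    simp only [evalIN] at h
    split at h
    · rename_i A hA
      split at h
      · rename_i W hW
        simp only [Option.some.injEq] at h
        subst h
        have h1 := (MC.mem_expI hS hpi hW (ih hA)).2
        rw [Complex.exp_ofReal_mul_I_im] at h1
        simpa [evalRN] using h1
      · simp at h
    · simp at h
  | inv e ih =>
    intro Z h
    simp only [evalIN] at h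
    split at h
    · rename_i A hA
      exact mem_invI hS h (ih hA)
    · simp at h
  | sqrt e ih =>
    intro Z h
    simp only [evalIN] at h
    split at h
    · rename_i A hA
      exact mem_sqrtI hS h (ih hA)
    · simp at h

/-- **One level of the product rule, folded**: `Σ_{j<m} w_j · g(node_j)` over the first `m` entries of an axis table
(`none` if an entry is missing or an inner evaluation fails). [cite: DavisRabinowitz1984, Sect. 5.6 (5.6.3)] -/
def levelSum (S : ℕ) (g : MI → Option MI) (tab : List (Option (MI × MI))) : ℕ → Option MI
  | 0 => some (MI.ofInt S 0)
  | j + 1 =>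
    match levelSum S g tab j, tab.getD j none with
    | some acc, some q =>
      match g q.1 with
      | some F => some (acc.add (MI.mul S q.2 F))
      | none => none
    | _, _ => none

/-- A `some` level saw `m` present table entries and `m` successful inner evaluations. [folklore] -/
private theorem levelSum_isSome {S : ℕ} {g : MI → Option MI} {tab : List (Option (MI × MI))} :
    ∀ (m : ℕ) {R : MI}, levelSum S g tab m = some R →
      ∀ j < m, ∃ q, tab.getD j none = some q ∧ ∃ F, g q.1 = some F
  | 0 => fun _ j hj => absurd hj (Nat.not_lt_zero j)
  | m + 1 => by
    intro h j hj
    simp only [levelSum] at h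
    split at h
    · rename_i acc q hacc hq
      split at h
      · rename_i F hF
        rcases Nat.lt_succ_iff_lt_or_eq.mp hj with hlt | heq
        · exact levelSum_isSome m hacc j hlt
        · subst heq
          exact ⟨q, hq, F, hF⟩
      · simp at h
    · simp at h

/-- **Soundness of `levelSum`**: if the table weights enclose `wts j` and the inner evaluations enclose `vals j`,
the level encloses `Σ_{j<m} wts j · vals j`. [cite: Moore1979, Thm. 3.1] -/
theorem levelSum_mem {S : ℕ} {g : MI → Option MI} {tab : List (Option (MI × MI))} (hS : 0 < S)
    (wts vals : ℕ → ℝ) :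
    ∀ (m : ℕ) {R : MI}, levelSum S g tab m = some R →
      (∀ j < m, ∀ q, tab.getD j none = some q → MI.mem S (wts j) q.2) →
      (∀ j < m, ∀ q F, tab.getD j none = some q → g q.1 = some F → MI.mem S (vals j) F) →
        MI.mem S (∑ j ∈ Finset.range m, wts j * vals j) R
  | 0 => by
    intro h _ _
    simp only [levelSum, Option.some.injEq] at h
    subst h
    simpa using MI.mem_ofInt S 0
  | m + 1 => by
    intro h hw hv
    simp only [levelSum] at h
    split at h
    · rename_i acc q hacc hq
      split at h
      · rename_i F hF
        simp only [Option.some.injEq] at h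
        subst h
        rw [Finset.sum_range_succ]
        have ih := levelSum_mem hS wts vals m hacc (fun j hj q' hq' => hw j (Nat.lt_succ_of_lt hj) q' hq')
          (fun j hj q' F' hq' hF' => hv j (Nat.lt_succ_of_lt hj) q' F' hq' hF')
        exact MI.mem_add ih (MI.mem_mul hS (hw m (Nat.lt_succ_self m) q hq)
          (hv m (Nat.lt_succ_self m) q F hq hF))
      · simp at h
    · simp at h

/-- Reading the axis table. [folklore] -/
private theorem axisTab_getD' {a b : ℚ} {n S T : ℕ} {cs : List ℤ} {i : ℕ} (hi : i < n + 1) :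
    (axisTab a b n S T cs).getD i none = axisNW a b n S T (cs.getD i 0) := by
  rw [axisTab, List.getD_eq_getElem?_getD, List.getElem?_map, List.getElem?_range hi]
  rfl

/-- **The tensor sum** ((5.6.3), folded axis by axis): with the enclosures `XS` of the already fixed outer
coordinates, sum over the table of the current axis the weight times the tensor sum of the remaining axes at `XS`
extended by the node; at the innermost level evaluate the integrand. Structurally recursive in the axes (so that
the kernel's `decide` unfolds it). [cite: DavisRabinowitz1984, Sect. 5.6 (5.6.3)] [cite: Moore1979, Sect. 4.4 (4.12)] -/
def tensor (e : EN) (S K k : ℕ) (piI : MI) (T : ℕ) : List Axis → List MI → Option MI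
  | [] => fun XS => evalIN S K k piI XS e
  | ax :: rest => fun XS =>
      levelSum S (fun X => tensor e S K k piI T rest (XS ++ [X])) (axisTab ax.lo ax.hi ax.deg S T ax.cands)
        (ax.deg + 1)

/-- **Soundness of the tensor sum**: if the candidates of every axis are separated and the sum succeeds, it
encloses the product rule applied to the integrand at the environments extending the enclosed outer coordinates
(the accepted brackets of each axis are exactly the nodes of its rule, `axis_nodes`).
[cite: DavisRabinowitz1984, Sect. 5.6 (5.6.3)] [cite: Szego1939, Thm. 3.3.1] [cite: Moore1979, Thm. 3.1] -/
theorem tensor_mem {e : EN} {S K k T : ℕ} (hS : 0 < S) (hT : 0 < T) {piI : MI} (hpi : MI.mem S Real.pi piI) :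
    ∀ (axes : List Axis) (xs : List ℝ) (XS : List MI),
      (∀ ax ∈ axes, ∀ j < ax.deg, ax.cands.getD j 0 + 2 < ax.cands.getD (j + 1) 0) →
      Encl S xs XS → ∀ {D : MI}, tensor e S K k piI T axes XS = some D →
        MI.mem S (ruleN axes (fun env => evalRN e (xs.foldr scons env))) D
  | [], xs, XS, _, hxs, D, hD => by
      simp only [tensor] at hD
      simpa only [ruleN] using mem_evalIN hS hpi hxs e hD
  | ax :: rest, xs, XS, hsep, hxs, D, hD => by
      simp only [tensor] at hD
      have hsepax := hsep ax (by simp)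
      have hsepr : ∀ ax' ∈ rest, ∀ j < ax'.deg, ax'.cands.getD j 0 + 2 < ax'.cands.getD (j + 1) 0 :=
        fun ax' h => hsep ax' (List.mem_cons_of_mem _ h)
      have hsome := levelSum_isSome (ax.deg + 1) hD
      have hNW : ∀ i < ax.deg + 1, ∃ q, axisNW ax.lo ax.hi ax.deg S T (ax.cands.getD i 0) = some q := by
        intro i hi
        obtain ⟨q, hq, -⟩ := hsome i hi
        exact ⟨q, by rw [← axisTab_getD' hi]; exact hq⟩
      obtain ⟨ξ, hξn, hξb, hξsum⟩ := axis_nodes hS hT hsepax hNW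
      -- the rule of this axis, bracket by bracket
      set xn : ℝ → ℝ := fun x => ((ax.hi : ℝ) - ax.lo) / 2 * x + ((ax.lo : ℝ) + ax.hi) / 2 with hxn
      set v : ℝ → ℝ := fun x => ((ax.hi : ℝ) - ax.lo) / 2 * gaussLegendreWeight (ax.deg + 1) x with hv
      set R : ℝ → ℝ := fun t => ruleN rest (fun env => evalRN e (xs.foldr scons (scons t env))) with hR
      have hQ : ruleN (ax :: rest) (fun env => evalRN e (xs.foldr scons env)) =
          ∑ i : Fin (ax.deg + 1), v (ξ i) * R (xn (ξ i)) := by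
        rw [hξsum (fun x => v x * R (xn x))]
        simp only [ruleN, glRule, hv, hR, hxn]
      set wts : ℕ → ℝ := fun i => if hi : i < ax.deg + 1 then v (ξ ⟨i, hi⟩) else 0 with hwts
      set vals : ℕ → ℝ := fun i => if hi : i < ax.deg + 1 then R (xn (ξ ⟨i, hi⟩)) else 0 with hvals
      have hw : ∀ j < ax.deg + 1, ∀ q, (axisTab ax.lo ax.hi ax.deg S T ax.cands).getD j none = some q →
          MI.mem S (wts j) q.2 := by
        intro j hj q hq
        rw [axisTab_getD' hj] at hq
        have hsp := (axisNW_spec hS hT hq).2 (ξ ⟨j, hj⟩) (hξn _) (hξb ⟨j, hj⟩).1 (hξb ⟨j, hj⟩).2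
        simp only [hwts, dif_pos hj]
        exact hsp.2
      have hvl : ∀ j < ax.deg + 1, ∀ q F, (axisTab ax.lo ax.hi ax.deg S T ax.cands).getD j none = some q →
          tensor e S K k piI T rest (XS ++ [q.1]) = some F → MI.mem S (vals j) F := by
        intro j hj q F hq hF
        rw [axisTab_getD' hj] at hq
        have hsp := (axisNW_spec hS hT hq).2 (ξ ⟨j, hj⟩) (hξn _) (hξb ⟨j, hj⟩).1 (hξb ⟨j, hj⟩).2
        have ih := tensor_mem hS hT hpi rest (xs ++ [xn (ξ ⟨j, hj⟩)]) (XS ++ [q.1]) hsepr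
          (hxs.snoc hsp.1) hF
        simp only [hvals, dif_pos hj, hR]
        simpa only [List.foldr_append, List.foldr_cons, List.foldr_nil] using ih
      have hmem := levelSum_mem hS wts vals (ax.deg + 1) hD hw hvl
      rw [hQ]
      have hsumEq : ∑ j ∈ Finset.range (ax.deg + 1), wts j * vals j =
          ∑ i : Fin (ax.deg + 1), v (ξ i) * R (xn (ξ i)) := by
        rw [Finset.sum_range]
        refine Finset.sum_congr rfl (fun i _ => ?_)
        simp only [hwts, hvals, dif_pos i.2]
      rw [← hsumEq]
      exact hmem

/-- Haber's bound as a rational, by the recursion of `errN` over a sublist starting at axis `k`: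
`errQL axes e (ax :: rest) k = (hi − lo) · errQL axes e rest (k + 1) + volQ rest · epsQ axes e k`.
[cite: DavisRabinowitz1984, Sect. 5.6 (5.6.3)] -/
def errQL (axes : List Axis) (e : EN) : List Axis → ℕ → ℚ
  | [], _ => 0
  | ax :: rest, k => (ax.hi - ax.lo) * errQL axes e rest (k + 1) + volQ rest * epsQ axes e k

/-- **The certified error radius** `Σ_k (Π_{j≠k} (hi_j − lo_j)) · epsQ axes e k`.
[cite: DavisRabinowitz1984, Sect. 5.6 (5.6.3)] [cite: Trefethen2008, Thm. 4.5] -/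
def errQN (axes : List Axis) (e : EN) : ℚ := errQL axes e axes 0

/-- The rational radius is Haber's bound at the certified section radii. [cite: DavisRabinowitz1984, Sect. 5.6 (5.6.3)] -/
theorem errQL_cast (axes : List Axis) (e : EN) : ∀ (sub : List Axis) (k : ℕ),
    ((errQL axes e sub k : ℚ) : ℝ) = errN sub k (fun j => ((epsQ axes e j : ℚ) : ℝ))
  | [], _ => by simp [errQL, errN]
  | ax :: rest, k => by
      simp only [errQL, errN]
      push_cast
      rw [errQL_cast axes e rest (k + 1)]

/-- The certificate data: the enclosure `D ∋ Q·S` of the product rule's value and `E ∋ errQN·S` of the error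
radius (`none` if `π` or a term cannot be enclosed) — `#eval` it to choose `lo, hi`.
[cite: DavisRabinowitz1984, Sect. 5.6 (5.6.3)] -/
def glDataN (e : EN) (axes : List Axis) (S T K k : ℕ) : Option (MI × MI) :=
  match MI.pi S K with
  | none => none
  | some piI =>
    match tensor e S K k piI T axes [] with
    | none => none
    | some D => some (D, ofRat S (errQN axes e))

/-- The per-axis checks: `rho > 1`, `lo < hi`, separated candidates (`c_j + 2 < c_{j+1}` for `j < deg`).
[cite: Petras2002, Sect. 3 (2)] [cite: Szego1939, Thm. 3.3.1] -/
def axisOK (ax : Axis) : Bool :=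
  decide (1 < ax.rho) && decide (ax.lo < ax.hi) &&
    decide (∀ j < ax.deg, ax.cands.getD j 0 + 2 < ax.cands.getD (j + 1) 0)

/-- The side conditions of the sections of the first `m` axes. [cite: Petras2002, Sect. 3 (2)] -/
def secOK (axes : List Axis) (e : EN) : ℕ → Bool
  | 0 => true
  | m + 1 => secOK axes e m && eokN (secBoxes axes m) e

/-- [folklore] -/
private theorem secOK_spec {axes : List Axis} {e : EN} :
    ∀ (m : ℕ), secOK axes e m = true → ∀ k < m, eokN (secBoxes axes k) e = true
  | 0, _, k, hk => absurd hk (Nat.not_lt_zero k)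
  | m + 1, h, k, hk => by
      simp only [secOK, Bool.and_eq_true] at h
      rcases Nat.lt_succ_iff_lt_or_eq.mp hk with hlt | heq
      · exact secOK_spec m h.1 k hlt
      · subst heq
        exact h.2

/-- **The certificate.**  `glCheckN e axes S T K k lo hi` checks, by integer arithmetic only: every axis passes
`axisOK`, the side conditions of the sections of every axis (`eokN (secBoxes axes k) e`), `S, T > 0`, that every
bracket of every axis passes `nodeW` and every one of the `Π (deg_k + 1)` integrand evaluations succeeds, and that the
tensor sum `± errQN` computed at scale `S` lies inside `[lo, hi]` — the product Gauss rule of (5.6.3) with Haber's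
error estimate, every one-dimensional step being a Petras–Johansson step with certified rather than tabulated nodes.
[cite: DavisRabinowitz1984, Sect. 5.6 (5.6.3)] [cite: Petras2002, Sect. 3 (2)] [cite: Johansson2018, Sect. 2] -/
def glCheckN (e : EN) (axes : List Axis) (S T K k : ℕ) (lo hi : ℚ) : Bool :=
  axes.all axisOK && secOK axes e axes.length && decide (0 < S) && decide (0 < T) &&
    match glDataN e axes S T K k with
    | none => false
    | some D =>
      decide (lo.num * (S : ℤ) ≤ (D.1.lo - D.2.hi) * (lo.den : ℤ)) &&
        decide ((D.1.hi + D.2.hi) * (hi.den : ℤ) ≤ hi.num * (S : ℤ))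

/-- A uniform bound of the integrand on the box (from the section data of axis `0`; trivial for `d = 0`).
[folklore] -/
private theorem exists_bound {e : EN} {axes : List Axis}
    (hax : ∀ ax ∈ axes, 1 < ax.rho ∧ ax.lo < ax.hi ∧ ∀ j < ax.deg, ax.cands.getD j 0 + 2 < ax.cands.getD (j + 1) 0)
    (hsec : ∀ k < axes.length, eokN (secBoxes axes k) e = true) :
    ∃ M : ℝ, ∀ env, InBox axes env → |evalRN e env| ≤ M := by
  cases axes with
  | nil =>
    refine ⟨|evalRN e fun _ => 0|, fun env henv => ?_⟩
    have h0 : env = fun _ => 0 := henv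
    subst h0
    exact le_rfl
  | cons ax rest =>
    have hk : 0 < (ax :: rest).length := by simp
    have h0 := hax ax (by simp)
    exact ⟨_, fun env henv => abs_evalRN_le hk (by simpa using h0.1) (by simpa using h0.2.1) (hsec 0 hk) henv⟩

/-- **Kernel-checked enclosure of a `d`-fold iterated integral by product Gauss–Legendre cubature.**  One `decide`
of `glCheckN` proves `iterI axes (evalRN e) ∈ [lo, hi]`: the brackets of each axis certify exactly the nodes of its
rule (`axis_nodes`), so the interval tensor sum encloses the product rule's value (`tensor_mem`), and Part C
(Trefethen's bound on every section, Haber's estimate iterated over the axes) bounds its distance to the iterated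
integral by `errQN`. [cite: DavisRabinowitz1984, Sect. 5.6 (5.6.3)] [cite: Trefethen2008, Thm. 4.5]
[cite: Petras2002, Sect. 3 (2)] [cite: Szego1939, Thm. 3.3.1] -/
theorem integral_mem_of_glCheckN {e : EN} {axes : List Axis} {S T K k : ℕ} {lo hi : ℚ}
    (h : glCheckN e axes S T K k lo hi = true) :
    iterI axes (evalRN e) ∈ Set.Icc (lo : ℝ) hi := by
  unfold glCheckN at h
  simp only [Bool.and_eq_true, decide_eq_true_eq] at h
  obtain ⟨⟨⟨⟨hall, hsecOK⟩, hS⟩, hT⟩, hrest⟩ := h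
  split at hrest
  · simp at hrest
  rename_i D hD
  simp only [Bool.and_eq_true, decide_eq_true_eq] at hrest
  obtain ⟨h1, h2⟩ := hrest
  unfold glDataN at hD
  split at hD
  · simp at hD
  rename_i piI hpiEq
  split at hD
  · simp at hD
  rename_i Dg hDg
  simp only [Option.some.injEq] at hD
  subst hD
  dsimp only at h1 h2
  have hSr : (0 : ℝ) < S := by exact_mod_cast hS
  have hpi := MI.mem_pi S hpiEq
  -- the per-axis data
  have hax : ∀ ax ∈ axes, 1 < ax.rho ∧ ax.lo < ax.hi ∧
      ∀ j < ax.deg, ax.cands.getD j 0 + 2 < ax.cands.getD (j + 1) 0 := by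
    intro ax hmem
    have hx := List.all_eq_true.mp hall ax hmem
    simp only [axisOK, Bool.and_eq_true, decide_eq_true_eq] at hx
    exact ⟨hx.1.1, hx.1.2, hx.2⟩
  have hsec := secOK_spec axes.length hsecOK
  have hlt : ∀ ax ∈ axes, ax.lo < ax.hi := fun ax hmem => (hax ax hmem).2.1
  -- the tensor sum encloses the rule
  have hmem : MI.mem S (ruleN axes (evalRN e)) Dg := by
    have := tensor_mem hS hT hpi axes [] [] (fun ax hmem => (hax ax hmem).2.2) (Encl.nil S) hDg
    simpa only [List.foldr_nil] using this
  -- the error estimate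
  obtain ⟨M, hM⟩ := exists_bound hax hsec
  have habs : |iterI axes (evalRN e) - ruleN axes (evalRN e)| ≤
      errN axes 0 (fun j => ((epsQ axes e j : ℚ) : ℝ)) := by
    refine abs_iterI_sub_ruleN_le axes (evalRN e) _ M hlt (measurable_evalRN e) hM ?_
    intro k hk env henv
    have hk' := hax _ (axAt_mem hk)
    exact abs_integral_sub_gl_le_axis hk hk'.1 hk'.2.1 (hsec k hk) henv
  have herr : MI.mem S (errN axes 0 (fun j => ((epsQ axes e j : ℚ) : ℝ))) (ofRat S (errQN axes e)) := by
    rw [← errQL_cast axes e axes 0]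
    exact mem_ofRat S (errQN axes e)
  set I : ℝ := iterI axes (evalRN e) with hIdef
  set Q : ℝ := ruleN axes (evalRN e) with hQdef
  set ε : ℝ := errN axes 0 (fun j => ((epsQ axes e j : ℚ) : ℝ)) with hε
  rw [abs_le] at habs
  obtain ⟨hA1, hA2⟩ := hmem
  obtain ⟨hB1, hB2⟩ := herr
  have h1r : (lo.num : ℝ) * S ≤ ((Dg.lo : ℝ) - (ofRat S (errQN axes e)).hi) * lo.den := by
    exact_mod_cast h1
  have h2r : ((Dg.hi : ℝ) + (ofRat S (errQN axes e)).hi) * hi.den ≤ hi.num * S := by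
    exact_mod_cast h2
  have hdlo : (0 : ℝ) < lo.den := by exact_mod_cast lo.den_pos
  have hdhi : (0 : ℝ) < hi.den := by exact_mod_cast hi.den_pos
  constructor
  · have keylo : (lo.num : ℝ) * S ≤ I * lo.den * S := by
      calc (lo.num : ℝ) * S ≤ ((Dg.lo : ℝ) - (ofRat S (errQN axes e)).hi) * lo.den := h1r
        _ ≤ (Q - ε) * S * lo.den := by
            apply mul_le_mul_of_nonneg_right _ hdlo.le
            linarith
        _ ≤ I * S * lo.den := by
            apply mul_le_mul_of_nonneg_right _ hdlo.le
            apply mul_le_mul_of_nonneg_right _ hSr.le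
            linarith
        _ = I * lo.den * S := by ring
    have keylo' : (lo.num : ℝ) ≤ I * lo.den := le_of_mul_le_mul_right keylo hSr
    show (lo : ℝ) ≤ I
    rw [Rat.cast_def, div_le_iff₀ hdlo]
    exact keylo'
  · have keyhi : I * hi.den * S ≤ (hi.num : ℝ) * S := by
      calc I * hi.den * S = I * S * hi.den := by ring
        _ ≤ (Q + ε) * S * hi.den := by
            apply mul_le_mul_of_nonneg_right _ hdhi.le
            apply mul_le_mul_of_nonneg_right _ hSr.le
            linarith
        _ ≤ ((Dg.hi : ℝ) + (ofRat S (errQN axes e)).hi) * hi.den := by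
            apply mul_le_mul_of_nonneg_right _ hdhi.le
            linarith
        _ ≤ hi.num * S := h2r
    have keyhi' : I * hi.den ≤ (hi.num : ℝ) := le_of_mul_le_mul_right keyhi hSr
    show I ≤ (hi : ℝ)
    rw [Rat.cast_def, le_div_iff₀ hdhi]
    exact keyhi'

/-! #### Slicing the outer axis: one `decide` per slice -/

/-- What a passing certificate contains besides the enclosure: every axis is nondegenerate and the integrand is
bounded on the box. [folklore] -/
private theorem glCheckN_spec {e : EN} {axes : List Axis} {S T K k : ℕ} {lo hi : ℚ}
    (h : glCheckN e axes S T K k lo hi = true) :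
    (∀ ax ∈ axes, ax.lo < ax.hi) ∧ ∃ M : ℝ, ∀ env, InBox axes env → |evalRN e env| ≤ M := by
  unfold glCheckN at h
  simp only [Bool.and_eq_true, decide_eq_true_eq] at h
  obtain ⟨⟨⟨⟨hall, hsecOK⟩, -⟩, -⟩, -⟩ := h
  have hax : ∀ ax ∈ axes, 1 < ax.rho ∧ ax.lo < ax.hi ∧
      ∀ j < ax.deg, ax.cands.getD j 0 + 2 < ax.cands.getD (j + 1) 0 := by
    intro ax hmem
    have hx := List.all_eq_true.mp hall ax hmem
    simp only [axisOK, Bool.and_eq_true, decide_eq_true_eq] at hx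
    exact ⟨hx.1.1, hx.1.2, hx.2⟩
  exact ⟨fun ax hmem => (hax ax hmem).2.1, exists_bound hax (secOK_spec axes.length hsecOK)⟩

/-- **Integrability of the outer integrand of a certified box**: the slice integrals
`x ↦ iterI rest (f ∘ scons x)` are interval integrable on the outer axis (measurable by the Fubini bookkeeping,
bounded by `volQ rest · M`) — what `intervalIntegral.integral_add_adjacent_intervals` needs to add the
enclosures of adjacent slices. [cite: DavisRabinowitz1984, Sect. 5.6 (5.6.3)] -/
theorem intervalIntegrable_outer_of_glCheckN {e : EN} {ax : Axis} {rest : List Axis} {S T K k : ℕ}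
    {lo hi : ℚ} (h : glCheckN e (ax :: rest) S T K k lo hi = true) :
    IntervalIntegrable (fun x => iterI rest fun env => evalRN e (scons x env)) volume (ax.lo : ℝ) ax.hi := by
  obtain ⟨hlt, M, hM⟩ := glCheckN_spec h
  have hab : (ax.lo : ℝ) ≤ ax.hi := by exact_mod_cast (hlt ax (by simp)).le
  have haxr : ∀ ax' ∈ rest, ax'.lo ≤ ax'.hi := fun ax' h' => (hlt ax' (List.mem_cons_of_mem _ h')).le
  have hAm : Measurable fun x => iterI rest (fun env => evalRN e (scons x env)) :=
    measurable_iterI_param rest (fun x env => evalRN e (scons x env))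
      ((measurable_evalRN e).comp measurable_scons)
  exact intervalIntegrable_of_bdd hAm hab
    (fun x hx => abs_iterI_le rest _ haxr (fun env henv => hM _ (InBox_scons hx henv)))

/-- **Slicing the outer axis.**  Two certificates for the slices `[a, m] × rest` and `[m, b] × rest` (each its
own `decide`, with its own `ρ`, degree and scales) enclose the iterated integral over `[a, b] × rest` in the sum
of their intervals — the way past the budget of a single kernel evaluation. [cite: DavisRabinowitz1984, Sect. 5.6 (5.6.3)] -/
theorem integral_mem_of_glCheckN_split {e : EN} {a m b ρ₁ ρ₂ : ℚ} {n₁ n₂ : ℕ} {cs₁ cs₂ : List ℤ}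
    {rest : List Axis} {S₁ T₁ K₁ k₁ S₂ T₂ K₂ k₂ : ℕ} {lo₁ hi₁ lo₂ hi₂ : ℚ}
    (h₁ : glCheckN e (⟨a, m, ρ₁, n₁, cs₁⟩ :: rest) S₁ T₁ K₁ k₁ lo₁ hi₁ = true)
    (h₂ : glCheckN e (⟨m, b, ρ₂, n₂, cs₂⟩ :: rest) S₂ T₂ K₂ k₂ lo₂ hi₂ = true)
    (ρ : ℚ) (n : ℕ) (cs : List ℤ) :
    iterI (⟨a, b, ρ, n, cs⟩ :: rest) (evalRN e) ∈ Set.Icc ((lo₁ + lo₂ : ℚ) : ℝ) ((hi₁ + hi₂ : ℚ) : ℝ) := by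
  have i₁ := intervalIntegrable_outer_of_glCheckN h₁
  have i₂ := intervalIntegrable_outer_of_glCheckN h₂
  have e₁ := integral_mem_of_glCheckN h₁
  have e₂ := integral_mem_of_glCheckN h₂
  simp only [iterI, Set.mem_Icc] at e₁ e₂ ⊢
  dsimp only at i₁ i₂
  rw [← intervalIntegral.integral_add_adjacent_intervals i₁ i₂]
  push_cast
  exact ⟨by linarith [e₁.1, e₂.1], by linarith [e₁.2, e₂.2]⟩

/-- The axis with its node candidates filled in by the untrusted search `glCands deg T`.
[cite: Petras2002, Sect. 3 (2)] -/
def fillCands (T : ℕ) (ax : Axis) : Axis := ⟨ax.lo, ax.hi, ax.rho, ax.deg, glCands ax.deg T⟩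

/-- [folklore] -/
private theorem iterI_fillCands (T : ℕ) : ∀ (axes : List Axis) (f : (ℕ → ℝ) → ℝ),
    iterI (axes.map (fillCands T)) f = iterI axes f
  | [], _ => rfl
  | ax :: rest, f => by simp only [List.map_cons, iterI, fillCands, iterI_fillCands T rest]

/-- **The certificate (self-contained form)**: `glCheckN` with the node candidates of every axis computed inside
the check (the kernel then also runs the `d` Newton searches; for large degrees paste `#eval glCands deg T` into the
axes instead). [cite: Petras2002, Sect. 3 (2)] -/
def glCheckNS (e : EN) (axes : List Axis) (S T K k : ℕ) (lo hi : ℚ) : Bool :=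
  glCheckN e (axes.map (fillCands T)) S T K k lo hi

/-- **Kernel-checked enclosure of a `d`-fold iterated integral, self-contained form.**
[cite: DavisRabinowitz1984, Sect. 5.6 (5.6.3)] [cite: Trefethen2008, Thm. 4.5] [cite: Petras2002, Sect. 3 (2)] -/
theorem integral_mem_of_glCheckNS {e : EN} {axes : List Axis} {S T K k : ℕ} {lo hi : ℚ}
    (h : glCheckNS e axes S T K k lo hi = true) : iterI axes (evalRN e) ∈ Set.Icc (lo : ℝ) hi := by
  rw [← iterI_fillCands T axes]
  exact integral_mem_of_glCheckN h

end GaussLegendreND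

end Literature.Analysis.ValidatedNumerics
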